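import Literature.Barriers.QuantumFields.FiniteTemperatureOneLayerReflection
import HarnessLib

/-!
# Gaussian domination for Borgs–Seiler's one-layer model

Companion to `FiniteTemperatureOneLayer` / `FiniteTemperatureOneLayerReflection`. For the
one-layer model on the even torus `(ℤ/L)^d` (`L ≥ 4`) with a continuous unitary matrix
representation `ρ` and couplings `J_E, J_M ≥ 0` we prove **Gaussian domination**
`Z(h) ≤ Z(0)` (`OneLayer.gaussZ_le_gaussZ_zero`) for the functional
`Z(h) = ∫ e^{-S(U)} exp{J_E Σ_{(x,i)} [Re(h̄_{x,i} (χ(u_x) - χ(u_{x+eᵢ}))) - (N/2)|h_{x,i}|²]} ∏dg`,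
`h : bonds → ℂ` — which is Borgs–Seiler's perturbed partition function `Z({h})` of §III.1
("replacing in (III.1) or (III.3) all `u_x` by `u_x - h_x`", here with an independent scalar
shift `h_{x,i} v_{x,i}` of the covariant difference `u_x v_{x,i} - v_{x,i} u_{x+eᵢ}` on every bond:
`-(J_E/2)‖u_x v - v u_y - h v‖²_{HS} = J_E Re χ(U_P) - J_E N + J_E Re(h̄(χ(u_x) - χ(u_y))) - (J_E N/2)|h|²`).
Borgs–Seiler prove `|Z({h})| ≤ Z({0})` (Lemma III.1) with the transfer matrix and Hölder's
inequality for operators; here it is proved by REFLECTION POSITIVITY through the bond-bisecting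
hyperplanes of the torus (Fröhlich–Simon–Spencer / Fröhlich–Israel–Lieb–Simon; Friedli–Velenik
2017, Prop. 10.27), in the axial gauge of the crossing links:

1. `zWeight_split` — with the crossing `j`-links gauged to `1`
   (`integral_eq_integral_splice_crossLinks_one`), the integrand of `Z(h)` is
   `e^{c} e^{𝒜_h(U)} e^{𝒜_{θ*h}(ΘU)} exp{Σ_c p^h_c(U) p^{θ*h}_c(ΘU)}` where `𝒜_g` (`halfExp`) collects
   the electric bonds and magnetic plaquettes of the positive half and the single-site pieces
   `-(J_E/2)‖ρ(u_{y₊}) ∓ g/2‖²` of the crossing bonds, the features `p^g_c` (`feat`) are the real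
   and imaginary parts of the entries of `ρ(u_{y₊}) ∓ g/2` and of the positive spatial link of each
   crossing magnetic plaquette, and `θ*h` (`pullField`) is the reflected bond field
   (`(θ*h)(x,i) = ± h(mirror bond)`, sign `-` for `j`-bonds);
2. `gaussZ_sq_le` — the Cauchy–Schwarz inequality of reflection positivity with two different
   crossing couplings (`integral_mul_comp_mul_exp_sq_le`) and the cancellation of the crossing
   values give `Z(h)² ≤ Z(h⁺) Z(h⁻)`, `h^±` vanishing on the crossing bonds;
3. `gaussZ_le_gaussZ_zero` — the finite descent on the number of non-zero bonds
   (Kennedy–Lieb–Shastry; the tree's `GaussianDominationProofs`): a maximiser of `Z` over the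
   finitely many fields with values in `{0} ∪ ±range h` having the fewest non-zero bonds has none.

Everything here is proved; no facts.

References: C. Borgs, E. Seiler, Commun. Math. Phys. 91 (1983) 329–380, §III.1 (III.3)–(III.4),
Lemma III.1 (pp. 344–346); S. Friedli, Y. Velenik, *Statistical Mechanics of Lattice Systems*
(CUP 2017), §10.5.3 Prop. 10.27, Lemma 10.28; J. Fröhlich, B. Simon, T. Spencer, Commun. Math.
Phys. 50 (1976) 79. [BorgsSeiler1983] [FriedliVelenik2017]
-/

noncomputable section

open MeasureTheory Filter Topology
open scoped ComplexConjugate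

namespace Literature.Barriers.QuantumFields

namespace OneLayer

open Literature.Probability.LatticeModels (TorusSite)
open Literature.MathematicalPhysics.QuantumFieldTheory (haarProbability)
open Literature.MathematicalPhysics.QuantumFieldTheory.LatticeRP (piMeasure splice splice_apply)
open FiniteTemperature (Dir)

/-! ### Hilbert–Schmidt algebra of `N × N` matrices in real-feature form -/

section MatrixAlgebra

variable {N : ℕ}

/-- The real Hilbert–Schmidt pairing `Re tr(X Yᴴ) = Σ_{ab} (Re X_{ab} Re Y_{ab} + Im X_{ab} Im Y_{ab})`
in feature form. [folklore] -/
def reInner (X Y : Matrix (Fin N) (Fin N) ℂ) : ℝ :=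
  ∑ a, ∑ b, ((X a b).re * (Y a b).re + (X a b).im * (Y a b).im)

/-- The squared Hilbert–Schmidt norm `‖X‖² = Σ_{ab} |X_{ab}|²`. [folklore] -/
def hsNormSq (X : Matrix (Fin N) (Fin N) ℂ) : ℝ := ∑ a, ∑ b, ‖X a b‖ ^ 2

/-- `reInner X Y = Re tr(X Yᴴ)`. [folklore] -/
theorem reInner_eq_trace_re (X Y : Matrix (Fin N) (Fin N) ℂ) :
    reInner X Y = (X * Y.conjTranspose).trace.re := by
  rw [Matrix.trace]
  simp only [Matrix.diag_apply, Matrix.mul_apply, Matrix.conjTranspose_apply, Complex.re_sum,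
    reInner]
  refine Finset.sum_congr rfl fun a _ => Finset.sum_congr rfl fun b _ => ?_
  rw [Complex.star_def, Complex.mul_re, Complex.conj_re, Complex.conj_im]
  ring

/-- `reInner` is symmetric. [folklore] -/
theorem reInner_comm (X Y : Matrix (Fin N) (Fin N) ℂ) : reInner X Y = reInner Y X := by
  unfold reInner
  exact Finset.sum_congr rfl fun a _ => Finset.sum_congr rfl fun b _ => by ring

/-- `‖X‖² = reInner X X`. [folklore] -/
theorem hsNormSq_eq_reInner (X : Matrix (Fin N) (Fin N) ℂ) : hsNormSq X = reInner X X := by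
  unfold hsNormSq reInner
  refine Finset.sum_congr rfl fun a _ => Finset.sum_congr rfl fun b _ => ?_
  rw [Complex.sq_norm, Complex.normSq_apply]

/-- `‖X‖² ≥ 0`. [folklore] -/
theorem hsNormSq_nonneg (X : Matrix (Fin N) (Fin N) ℂ) : 0 ≤ hsNormSq X :=
  Finset.sum_nonneg fun _ _ => Finset.sum_nonneg fun _ _ => sq_nonneg _

/-- `‖X - Y‖² = ‖X‖² + ‖Y‖² - 2 reInner X Y`. [folklore] -/
theorem hsNormSq_sub (X Y : Matrix (Fin N) (Fin N) ℂ) :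
    hsNormSq (X - Y) = hsNormSq X + hsNormSq Y - 2 * reInner X Y := by
  have key : ∀ a b, ‖(X - Y) a b‖ ^ 2 =
      ‖X a b‖ ^ 2 + ‖Y a b‖ ^ 2 - 2 * ((X a b).re * (Y a b).re + (X a b).im * (Y a b).im) := by
    intro a b
    rw [Matrix.sub_apply, Complex.sq_norm, Complex.sq_norm, Complex.sq_norm, Complex.normSq_apply,
      Complex.normSq_apply, Complex.normSq_apply, Complex.sub_re, Complex.sub_im]
    ring
  unfold hsNormSq reInner
  rw [Finset.mul_sum, ← Finset.sum_add_distrib, ← Finset.sum_sub_distrib]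
  refine Finset.sum_congr rfl fun a _ => ?_
  rw [Finset.mul_sum, ← Finset.sum_add_distrib, ← Finset.sum_sub_distrib]
  exact Finset.sum_congr rfl fun b _ => key a b

/-- `‖X + Y‖² = ‖X‖² + ‖Y‖² + 2 reInner X Y`. [folklore] -/
theorem hsNormSq_add (X Y : Matrix (Fin N) (Fin N) ℂ) :
    hsNormSq (X + Y) = hsNormSq X + hsNormSq Y + 2 * reInner X Y := by
  have key : ∀ a b, ‖(X + Y) a b‖ ^ 2 =
      ‖X a b‖ ^ 2 + ‖Y a b‖ ^ 2 + 2 * ((X a b).re * (Y a b).re + (X a b).im * (Y a b).im) := by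
    intro a b
    rw [Matrix.add_apply, Complex.sq_norm, Complex.sq_norm, Complex.sq_norm, Complex.normSq_apply,
      Complex.normSq_apply, Complex.normSq_apply, Complex.add_re, Complex.add_im]
    ring
  unfold hsNormSq reInner
  rw [Finset.mul_sum, ← Finset.sum_add_distrib, ← Finset.sum_add_distrib]
  refine Finset.sum_congr rfl fun a _ => ?_
  rw [Finset.mul_sum, ← Finset.sum_add_distrib, ← Finset.sum_add_distrib]
  exact Finset.sum_congr rfl fun b _ => key a b

/-- `reInner` is additive in the second slot. [folklore] -/
theorem reInner_add_right (X Y Z : Matrix (Fin N) (Fin N) ℂ) :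
    reInner X (Y + Z) = reInner X Y + reInner X Z := by
  unfold reInner
  simp only [Matrix.add_apply, Complex.add_re, Complex.add_im, ← Finset.sum_add_distrib]
  exact Finset.sum_congr rfl fun a _ => Finset.sum_congr rfl fun b _ => by ring

/-- `reInner X (c • 1) = Re(c̄ tr X)`. [folklore] -/
theorem reInner_smul_one (X : Matrix (Fin N) (Fin N) ℂ) (c : ℂ) :
    reInner X (c • (1 : Matrix (Fin N) (Fin N) ℂ)) = (conj c * X.trace).re := by
  rw [reInner_eq_trace_re, Matrix.conjTranspose_smul, Matrix.conjTranspose_one, Matrix.mul_smul,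
    Matrix.mul_one, Matrix.trace_smul, Complex.star_def, smul_eq_mul]

/-- `‖c • 1‖² = N |c|²`. [folklore] -/
theorem hsNormSq_smul_one (c : ℂ) :
    hsNormSq (c • (1 : Matrix (Fin N) (Fin N) ℂ)) = N * ‖c‖ ^ 2 := by
  unfold hsNormSq
  have h : ∀ a b : Fin N, ‖(c • (1 : Matrix (Fin N) (Fin N) ℂ)) a b‖ ^ 2 =
      if a = b then ‖c‖ ^ 2 else 0 := by
    intro a b
    rw [Matrix.smul_apply, Matrix.one_apply]
    split_ifs <;> simp
  simp_rw [h, Finset.sum_ite_eq, Finset.mem_univ, if_true, Finset.sum_const, Finset.card_univ,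
    Fintype.card_fin, nsmul_eq_mul]

/-- The Hilbert–Schmidt norm of a unitary matrix: `‖A‖² = N`. [folklore] -/
theorem hsNormSq_of_mem_unitaryGroup {A : Matrix (Fin N) (Fin N) ℂ}
    (hA : A ∈ Matrix.unitaryGroup (Fin N) ℂ) : hsNormSq A = N := by
  have h := FiniteTemperature.sum_sum_conj_mul_self_of_unitary hA
  have h' : ∑ k, ∑ i, conj (A k i) * A k i = ((hsNormSq A : ℝ) : ℂ) := by
    unfold hsNormSq
    push_cast
    refine Finset.sum_congr rfl fun k _ => Finset.sum_congr rfl fun i _ => ?_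
    rw [mul_comm, Complex.mul_conj, Complex.normSq_eq_norm_sq]
    push_cast; rfl
  rw [h'] at h
  exact_mod_cast h

/-- For unitary `X, Y`: `‖X - Y‖² = 2N - 2 Re tr(X Yᴴ)`. [folklore] -/
theorem hsNormSq_sub_of_mem_unitaryGroup {X Y : Matrix (Fin N) (Fin N) ℂ}
    (hX : X ∈ Matrix.unitaryGroup (Fin N) ℂ) (hY : Y ∈ Matrix.unitaryGroup (Fin N) ℂ) :
    hsNormSq (X - Y) = 2 * N - 2 * (X * Y.conjTranspose).trace.re := by
  rw [hsNormSq_sub, hsNormSq_of_mem_unitaryGroup hX, hsNormSq_of_mem_unitaryGroup hY,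
    reInner_eq_trace_re]
  ring

/-- **The completed square of a crossing bond.** For unitary `X, Y` and scalars `c₁, c₂`:
`-½‖X + c₁‖² - ½‖Y + c₂‖² + reInner (X + c₁) (Y + c₂)
  = Re tr(X Yᴴ) + Re((c₂ - c₁)‾ (tr X - tr Y)) - (N/2)|c₂ - c₁|² - N`. This is the identity by
which the shifted electric term of a bond bisected by the mirror splits into a factor on each side
and a positive-type coupling across (Friedli–Velenik 2017, proof of Prop. 10.27:
`‖ω_i - ω_j + h_i - h_j‖² = ‖ω_i + h_i‖² + ‖ω_j + h_j‖² - 2(ω_i + h_i)·(ω_j + h_j)`). [cite: FriedliVelenik2017, §10.5.3, proof of Prop. 10.27] -/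
theorem crossing_identity {X Y : Matrix (Fin N) (Fin N) ℂ}
    (hX : X ∈ Matrix.unitaryGroup (Fin N) ℂ) (hY : Y ∈ Matrix.unitaryGroup (Fin N) ℂ) (c₁ c₂ : ℂ) :
    -(1 / 2 : ℝ) * hsNormSq (X + c₁ • 1) - (1 / 2 : ℝ) * hsNormSq (Y + c₂ • 1) +
        reInner (X + c₁ • 1) (Y + c₂ • 1) =
      (X * Y.conjTranspose).trace.re + (conj (c₂ - c₁) * (X.trace - Y.trace)).re -
        (N / 2 : ℝ) * ‖c₂ - c₁‖ ^ 2 - N := by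
  -- `-½‖P‖² - ½‖Q‖² + reInner P Q = -½‖P - Q‖²`
  have h1 : -(1 / 2 : ℝ) * hsNormSq (X + c₁ • 1) - (1 / 2 : ℝ) * hsNormSq (Y + c₂ • 1) +
      reInner (X + c₁ • 1) (Y + c₂ • 1) =
      -(1 / 2 : ℝ) * hsNormSq ((X + c₁ • 1) - (Y + c₂ • 1)) := by
    rw [hsNormSq_sub]; ring
  have h2 : (X + c₁ • 1) - (Y + c₂ • 1) = (X - Y) - (c₂ - c₁) • (1 : Matrix (Fin N) (Fin N) ℂ) := by
    rw [sub_smul]; abel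
  rw [h1, h2, hsNormSq_sub, hsNormSq_sub_of_mem_unitaryGroup hX hY, hsNormSq_smul_one,
    reInner_smul_one, Matrix.trace_sub]
  ring

/-- Representations into the unitary group: `ρ(g⁻¹) = ρ(g)ᴴ`. [folklore] -/
theorem rep_inv_eq_conjTranspose {G : Type*} [Group G] (ρ : G →* Matrix (Fin N) (Fin N) ℂ)
    (hρu : ∀ g, ρ g ∈ Matrix.unitaryGroup (Fin N) ℂ) (g : G) :
    ρ g⁻¹ = (ρ g).conjTranspose := by
  rw [FiniteTemperature.rep_inv_eq_star ρ hρu, Matrix.star_eq_conjTranspose]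

end MatrixAlgebra

/-! ### The functional `Z(h)` -/

section GaussZ

variable {d L : ℕ} {G : Type*} [Group G] {N : ℕ} (ρ : G →* Matrix (Fin N) (Fin N) ℂ)

/-- The shift term of the bond `b = (x, i)`:
`Re(h̄_b (χ(u_x) - χ(u_{x+eᵢ}))) - (N/2)|h_b|²`. [cite: BorgsSeiler1983, §III.1 (III.3)–(III.4) and Lemma III.1 (pp. 344–345)] -/
def shiftTerm (h : TorusSite d L × Fin d → ℂ) (U : Config d L G) (b : TorusSite d L × Fin d) : ℝ :=
  (conj (h b) * (polyakov ρ U b.1 - polyakov ρ U (b.1 + Pi.single b.2 1))).re -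
    (N / 2 : ℝ) * ‖h b‖ ^ 2

/-- The integrand of `Z(h)`: the Wilson weight times
`exp{J_E Σ_b [Re(h̄_b(χ(u_x) - χ(u_{x+eᵢ}))) - (N/2)|h_b|²]}`. [cite: BorgsSeiler1983, §III.1 Lemma III.1 (p. 344)] -/
def zWeight [NeZero L] (JE JM : ℝ) (h : TorusSite d L × Fin d → ℂ) (U : Config d L G) : ℝ :=
  weight ρ JE JM U * Real.exp (JE * ∑ b : TorusSite d L × Fin d, shiftTerm ρ h U b)

variable [TopologicalSpace G] [IsTopologicalGroup G] [CompactSpace G] [MeasurableSpace G]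
  [BorelSpace G]

/-- **The functional `Z(h)` of Gaussian domination** for the one-layer model: Borgs–Seiler's
perturbed partition function ("replacing in (III.1) or (III.3) all `u_x` by `u_x - h_x`"), in the
gauge-invariant bond form `Z(h) = ∫ e^{-S} exp{J_E Σ_b [Re(h̄_b(χ(u_x) - χ(u_{x+eᵢ}))) - (N/2)|h_b|²]}`
(`= e^{J_E N d L^d} ∫ exp{-(J_E/2) Σ_b ‖u_x v_b - v_b u_{x+eᵢ} - h_b v_b‖²_{HS} + J_M Σ Re χ(U_P)}`
for unitary `ρ`); `Z(0)` is the partition function. [cite: BorgsSeiler1983, §III.1 Lemma III.1 (p. 344)] -/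
def gaussZ [NeZero L] (JE JM : ℝ) (h : TorusSite d L × Fin d → ℂ) : ℝ :=
  ∫ U, zWeight ρ JE JM h U ∂piMeasure (ι := Link d L) (haarProbability G)

omit [TopologicalSpace G] [IsTopologicalGroup G] [CompactSpace G] [MeasurableSpace G]
  [BorelSpace G] in
/-- At `h = 0` the shift terms vanish. [folklore] -/
theorem shiftTerm_zero (U : Config d L G) (b : TorusSite d L × Fin d) :
    shiftTerm ρ (0 : TorusSite d L × Fin d → ℂ) U b = 0 := by
  simp [shiftTerm]

omit [TopologicalSpace G] [IsTopologicalGroup G] [CompactSpace G] [MeasurableSpace G]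
  [BorelSpace G] in
/-- `Z(0)`'s integrand is the Wilson weight. [folklore] -/
theorem zWeight_zero [NeZero L] (JE JM : ℝ) (U : Config d L G) :
    zWeight ρ JE JM (0 : TorusSite d L × Fin d → ℂ) U = weight ρ JE JM U := by
  simp [zWeight, shiftTerm_zero]

/-- `Z(0)` is the partition function. [folklore] -/
theorem gaussZ_zero [NeZero L] (JE JM : ℝ) :
    gaussZ ρ JE JM (0 : TorusSite d L × Fin d → ℂ) =
      ∫ U, weight ρ JE JM U ∂piMeasure (ι := Link d L) (haarProbability G) := by
  unfold gaussZ
  simp_rw [zWeight_zero]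

omit [TopologicalSpace G] [IsTopologicalGroup G] [CompactSpace G] [MeasurableSpace G]
  [BorelSpace G] in
/-- The shift terms are gauge invariant. [folklore] -/
theorem shiftTerm_gaugeAct (h : TorusSite d L × Fin d → ℂ) (g : TorusSite d L → G) (U : Config d L G)
    (b : TorusSite d L × Fin d) : shiftTerm ρ h (gaugeAct g U) b = shiftTerm ρ h U b := by
  simp only [shiftTerm, polyakov_gaugeAct]

omit [TopologicalSpace G] [IsTopologicalGroup G] [CompactSpace G] [MeasurableSpace G]
  [BorelSpace G] in
/-- **The integrand of `Z(h)` is gauge invariant.** [cite: BorgsSeiler1983, §III.1 Prop. III.2 (p. 345)] -/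
theorem zWeight_gaugeAct [NeZero L] (JE JM : ℝ) (h : TorusSite d L × Fin d → ℂ)
    (g : TorusSite d L → G) (U : Config d L G) :
    zWeight ρ JE JM h (gaugeAct g U) = zWeight ρ JE JM h U := by
  simp only [zWeight, weight_gaugeAct, shiftTerm_gaugeAct]

omit [TopologicalSpace G] [IsTopologicalGroup G] [CompactSpace G] [MeasurableSpace G]
  [BorelSpace G] in
/-- The integrand of `Z(h)` is positive. [folklore] -/
theorem zWeight_pos [NeZero L] (JE JM : ℝ) (h : TorusSite d L × Fin d → ℂ) (U : Config d L G) :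
    0 < zWeight ρ JE JM h U :=
  mul_pos (weight_pos ρ JE JM U) (Real.exp_pos _)

omit [IsTopologicalGroup G] [CompactSpace G] [MeasurableSpace G] [BorelSpace G] in
/-- The shift terms are continuous. [folklore] -/
theorem continuous_shiftTerm (hρ : Continuous ρ) (h : TorusSite d L × Fin d → ℂ)
    (b : TorusSite d L × Fin d) : Continuous fun U : Config d L G => shiftTerm ρ h U b := by
  unfold shiftTerm
  exact (Complex.continuous_re.comp (continuous_const.mul ((continuous_polyakov ρ hρ _).sub
    (continuous_polyakov ρ hρ _)))).sub continuous_const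

omit [CompactSpace G] [MeasurableSpace G] [BorelSpace G] in
/-- The integrand of `Z(h)` is continuous. [folklore] -/
theorem continuous_zWeight [NeZero L] (hρ : Continuous ρ) (JE JM : ℝ) (h : TorusSite d L × Fin d → ℂ) :
    Continuous fun U : Config d L G => zWeight ρ JE JM h U :=
  (continuous_weight ρ hρ JE JM).mul (Real.continuous_exp.comp (continuous_const.mul
    (continuous_finsetSum _ fun b _ => continuous_shiftTerm ρ hρ h b)))

variable [SecondCountableTopology G]

omit [TopologicalSpace G] [IsTopologicalGroup G] [CompactSpace G] [MeasurableSpace G]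
  [BorelSpace G] [SecondCountableTopology G] in
/-- The integrand of `Z(h)` as a single exponential. [folklore] -/
theorem zWeight_eq_exp [NeZero L] (JE JM : ℝ) (h : TorusSite d L × Fin d → ℂ) (U : Config d L G) :
    zWeight ρ JE JM h U =
      Real.exp (minusAction ρ JE JM U + JE * ∑ b : TorusSite d L × Fin d, shiftTerm ρ h U b) := by
  rw [zWeight, weight, Real.exp_add]

/-- `Z(h) > 0`. [folklore] -/
theorem gaussZ_pos [NeZero L] (hρ : Continuous ρ) (JE JM : ℝ) (h : TorusSite d L × Fin d → ℂ) :
    0 < gaussZ ρ JE JM h := by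
  unfold gaussZ
  simp_rw [zWeight_eq_exp]
  refine integral_exp_pos (integrable_of_continuous (Real.continuous_exp.comp ?_))
  exact (continuous_minusAction ρ hρ JE JM).add (continuous_const.mul
    (continuous_finsetSum _ fun b _ => continuous_shiftTerm ρ hρ h b))

/-- The integrand of `Z(h)` is integrable. [folklore] -/
theorem integrable_zWeight [NeZero L] (hρ : Continuous ρ) (JE JM : ℝ) (h : TorusSite d L × Fin d → ℂ) :
    Integrable (zWeight ρ JE JM h) (piMeasure (ι := Link d L) (haarProbability G)) :=
  integrable_of_continuous (continuous_zWeight ρ hρ JE JM h)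

end GaussZ

/-! ### Positive, crossing and negative objects; splitting sums along the mirror -/

section Trichotomy

variable {d L : ℕ} (j : Fin d) (k : ZMod L) [NeZero L]

/-- `n(x) = L/2 ⇒ r x = x + e_j` (the upper crossing bonds are reflected onto themselves). [folklore] -/
theorem mirror_eq_add_single_of_jv (hL : Even L) {x : TorusSite d L} (hx : jv j k x = L / 2) :
    mirror j k x = x + Pi.single j 1 := by
  obtain ⟨M, hM⟩ := hL
  have hL2 : (L / 2 : ℕ) = M := by omega
  funext i
  by_cases hi : i = j
  · subst hi
    rw [mirror_apply_self, Pi.add_apply, Pi.single_eq_same]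
    have h1 : ((x i - k : ZMod L).val : ZMod L) = x i - k := ZMod.natCast_zmod_val _
    unfold jv at hx
    rw [hx, hL2] at h1
    have h2 : ((M : ℕ) : ZMod L) + (M : ℕ) = 0 := by
      rw [← Nat.cast_add, ← hM, ZMod.natCast_self]
    linear_combination (2 : ZMod L) * h1 - h2
  · rw [mirror_apply_of_ne j k hi, Pi.add_apply, Pi.single_apply, if_neg hi, add_zero]

omit [NeZero L] in
/-- `n(x) = 0 ⇒ r (x + e_j) = x` (the lower crossing bonds are reflected onto themselves). [folklore] -/
theorem mirror_add_single_eq_of_jv {x : TorusSite d L} (hx : jv j k x = 0) :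
    mirror j k (x + Pi.single j 1) = x := by
  funext i
  by_cases hi : i = j
  · subst hi
    rw [mirror_apply_self, Pi.add_apply, Pi.single_eq_same]
    unfold jv at hx
    have h1 : x i - k = 0 := by
      rw [ZMod.val_eq_zero] at hx; exact hx
    linear_combination (-2 : ZMod L) * h1
  · rw [mirror_apply_of_ne j k hi, Pi.add_apply, Pi.single_apply, if_neg hi, add_zero]

variable {α : Type*} [Fintype α] (base : α → TorusSite d L) (flag : α → Prop) [DecidablePred flag]
  (mobj : α → α)

/-- Positive objects (bonds, plaquettes) relative to the mirror: base point in the positive half,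
and — if the object extends across a `j`-bond — its far end too. [folklore] -/
def IsPosObj (a : α) : Prop := IsPosSite j k (base a) ∧ (flag a → jv j k (base a) < L / 2)

/-- Crossing objects: those extending across a `j`-bond bisected by the mirror. [folklore] -/
def IsCrossObj (a : α) : Prop := flag a ∧ (jv j k (base a) = 0 ∨ jv j k (base a) = L / 2)

/-- Decidability of `IsPosObj`. [folklore] -/
instance (a : α) : Decidable (IsPosObj j k base flag a) := by unfold IsPosObj; infer_instance
/-- Decidability of `IsCrossObj`. [folklore] -/
instance (a : α) : Decidable (IsCrossObj j k base flag a) := by unfold IsCrossObj; infer_instance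

variable {j k base flag mobj}

omit [Fintype α] in
/-- **Trichotomy.** Under the mirror-object hypotheses, every object is exactly one of: positive,
crossing, the mirror image of a positive object. [folklore] -/
theorem obj_trichotomy (hL : Even L) (hL4 : 4 ≤ L)
    (hbase : ∀ a, base (mobj a) =
      if flag a then mirror j k (base a) - Pi.single j 1 else mirror j k (base a))
    (hflag : ∀ a, flag (mobj a) ↔ flag a) (a : α) :
    (IsPosObj j k base flag a ∧ ¬ IsCrossObj j k base flag a ∧ ¬ IsPosObj j k base flag (mobj a)) ∨
    (¬ IsPosObj j k base flag a ∧ IsCrossObj j k base flag a ∧ ¬ IsPosObj j k base flag (mobj a)) ∨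
    (¬ IsPosObj j k base flag a ∧ ¬ IsCrossObj j k base flag a ∧ IsPosObj j k base flag (mobj a)) := by
  obtain ⟨M, hM⟩ := hL
  have hL2 : (L / 2 : ℕ) = M := by omega
  have hlt := jv_lt j k (base a)
  have hm := jv_mirror j k (by omega) (base a)
  simp only [IsPosObj, IsCrossObj, IsPosSite, hbase a, hflag a, hL2]
  by_cases hf : flag a
  · simp only [hf, if_true, forall_true_left, true_and]
    have hs := jv_sub_single_self j k (mirror j k (base a))
    rw [hs]
    split_ifs at hm hs ⊢ with h1 h2 h3 <;> omega
  · simp only [hf, if_false, IsEmpty.forall_iff, and_true, false_and, not_false_eq_true,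
      true_and]
    split_ifs at hm with h1 h2 <;> omega

/-- **Splitting a sum along the mirror**: `Σ_a F(a) = Σ_{a pos} F(a) + Σ_{a cross} F(a) + Σ_{a pos} F(mobj a)`.
[folklore] -/
theorem sum_eq_pos_add_cross_add_mirror {β : Type*} [AddCommMonoid β] (hL : Even L) (hL4 : 4 ≤ L)
    (hbase : ∀ a, base (mobj a) =
      if flag a then mirror j k (base a) - Pi.single j 1 else mirror j k (base a))
    (hflag : ∀ a, flag (mobj a) ↔ flag a) (hinv : ∀ a, mobj (mobj a) = a) (F : α → β) :
    ∑ a, F a = ∑ a ∈ Finset.univ.filter (IsPosObj j k base flag), F a +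
      ∑ a ∈ Finset.univ.filter (IsCrossObj j k base flag), F a +
      ∑ a ∈ Finset.univ.filter (IsPosObj j k base flag), F (mobj a) := by
  classical
  have htri := obj_trichotomy (mobj := mobj) hL hL4 hbase hflag
  -- split off the positive objects
  rw [← Finset.sum_filter_add_sum_filter_not Finset.univ (IsPosObj j k base flag) F, add_assoc]
  congr 1
  -- split the rest into crossing and mirror-of-positive
  rw [← Finset.sum_filter_add_sum_filter_not _ (IsCrossObj j k base flag), Finset.filter_filter,
    Finset.filter_filter]
  congr 1
  · refine Finset.sum_congr (Finset.filter_congr fun a _ => ?_) fun _ _ => rfl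
    rcases htri a with h | h | h <;> tauto
  · -- the non-positive non-crossing objects are the mirror images of the positive ones
    refine Finset.sum_nbij' mobj mobj (fun a ha => ?_) (fun a ha => ?_) (fun a _ => hinv a)
      (fun a _ => hinv a) (fun a _ => by rw [hinv])
    · simp only [Finset.mem_filter, Finset.mem_univ, true_and] at ha ⊢
      rcases htri a with h | h | h <;> tauto
    · simp only [Finset.mem_filter, Finset.mem_univ, true_and] at ha ⊢
      have hb := htri (mobj a)
      rw [hinv] at hb
      rcases hb with h | h | h <;> tauto

end Trichotomy

/-! ### Bonds and plaquettes as mirror objects -/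

section Objects

variable {d L : ℕ} (j : Fin d) (k : ZMod L) [NeZero L]

/-- The index type of the magnetic plaquettes: base point and ordered pair of directions. [folklore] -/
abbrev Plaq (d L : ℕ) : Type := TorusSite d L × {p : Fin d × Fin d // p.1 < p.2}

/-- A plaquette "touches `j`" if one of its directions is `j`. [folklore] -/
def touchesJ (q : Plaq d L) : Prop := q.2.1.1 = j ∨ q.2.1.2 = j

/-- Decidability of `touchesJ`. [folklore] -/
instance (q : Plaq d L) : Decidable (touchesJ j q) := by unfold touchesJ; infer_instance

/-- The mirror plaquette. [folklore] -/
def plaqMirror (q : Plaq d L) : Plaq d L := (plaqMirrorBase j k q.1 q.2.1.1 q.2.1.2, q.2)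

/-- Positive bonds. [folklore] -/
abbrev IsPosBond : TorusSite d L × Fin d → Prop := IsPosObj j k Prod.fst (fun b => b.2 = j)
/-- Crossing bonds. [folklore] -/
abbrev IsCrossBond : TorusSite d L × Fin d → Prop := IsCrossObj j k Prod.fst (fun b => b.2 = j)
/-- Positive plaquettes. [folklore] -/
abbrev IsPosPlaq : Plaq d L → Prop := IsPosObj j k Prod.fst (touchesJ j)
/-- Crossing plaquettes. [folklore] -/
abbrev IsCrossPlaq : Plaq d L → Prop := IsCrossObj j k Prod.fst (touchesJ j)

omit [NeZero L] in
/-- The base point of the mirror bond. [folklore] -/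
theorem bondMirror_base (b : TorusSite d L × Fin d) :
    (bondMirror j k b).1 = if b.2 = j then mirror j k b.1 - Pi.single j 1 else mirror j k b.1 := rfl

omit [NeZero L] in
/-- The mirror bond has the same direction. [folklore] -/
theorem bondMirror_flag (b : TorusSite d L × Fin d) : (bondMirror j k b).2 = j ↔ b.2 = j := Iff.rfl

omit [NeZero L] in
/-- The base point of the mirror plaquette. [folklore] -/
theorem plaqMirror_base (q : Plaq d L) :
    (plaqMirror j k q).1 =
      if touchesJ j q then mirror j k q.1 - Pi.single j 1 else mirror j k q.1 := rfl

omit [NeZero L] in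
/-- The mirror plaquette has the same directions. [folklore] -/
theorem plaqMirror_flag (q : Plaq d L) : touchesJ j (plaqMirror j k q) ↔ touchesJ j q := Iff.rfl

omit [NeZero L] in
/-- `plaqMirror` is an involution. [folklore] -/
theorem plaqMirror_plaqMirror (q : Plaq d L) : plaqMirror j k (plaqMirror j k q) = q := by
  rcases q with ⟨x, p⟩
  simp only [plaqMirror, Prod.mk.injEq, and_true]
  exact plaqMirrorBase_plaqMirrorBase j k x _ _

/-- Splitting a sum over bonds along the mirror. [folklore] -/
theorem sum_bond_split {β : Type*} [AddCommMonoid β] (hL : Even L) (hL4 : 4 ≤ L)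
    (F : TorusSite d L × Fin d → β) :
    ∑ b, F b = ∑ b ∈ Finset.univ.filter (IsPosBond j k), F b +
      ∑ b ∈ Finset.univ.filter (IsCrossBond j k), F b +
      ∑ b ∈ Finset.univ.filter (IsPosBond j k), F (bondMirror j k b) :=
  sum_eq_pos_add_cross_add_mirror hL hL4 (bondMirror_base j k) (bondMirror_flag j k)
    (bondMirror_bondMirror j k) F

/-- Splitting a sum over plaquettes along the mirror. [folklore] -/
theorem sum_plaq_split {β : Type*} [AddCommMonoid β] (hL : Even L) (hL4 : 4 ≤ L)
    (F : Plaq d L → β) :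
    ∑ q, F q = ∑ q ∈ Finset.univ.filter (IsPosPlaq j k), F q +
      ∑ q ∈ Finset.univ.filter (IsCrossPlaq j k), F q +
      ∑ q ∈ Finset.univ.filter (IsPosPlaq j k), F (plaqMirror j k q) :=
  sum_eq_pos_add_cross_add_mirror hL hL4 (plaqMirror_base j k) (plaqMirror_flag j k)
    (plaqMirror_plaqMirror j k) F

/-- Crossing bonds are `j`-bonds reflected onto themselves. [folklore] -/
theorem bondMirror_of_isCrossBond (hL : Even L) {b : TorusSite d L × Fin d} (hb : IsCrossBond j k b) :
    bondMirror j k b = b := by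
  rcases b with ⟨x, i⟩
  obtain ⟨hi, hx⟩ := hb
  simp only at hi hx
  subst hi
  simp only [bondMirror, if_true, Prod.mk.injEq, and_true]
  rcases hx with hx | hx
  · rw [← mirror_add_single_self, mirror_add_single_eq_of_jv i k hx]
  · rw [mirror_eq_add_single_of_jv i k hL hx, add_sub_cancel_right]

end Objects

/-! ### The half functional, the crossing features and the reflected field -/

section Split

variable {d L : ℕ} {G : Type*} [Group G] {N : ℕ} (ρ : G →* Matrix (Fin N) (Fin N) ℂ)
  (j : Fin d) (k : ZMod L) [NeZero L]

/-- `Re tr ρ` of the electric plaquette of the bond `b`. [folklore] -/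
def eRe (U : Config d L G) (b : TorusSite d L × Fin d) : ℝ := (ρ (eplaq U b.1 b.2)).trace.re

/-- `Re tr ρ` of the magnetic plaquette `q`. [folklore] -/
def mRe (U : Config d L G) (q : Plaq d L) : ℝ := (ρ (mplaq U q.1 q.2.1.1 q.2.1.2)).trace.re

/-- The shift term with an explicit coefficient. [folklore] -/
def shiftTermC (c : ℂ) (U : Config d L G) (b : TorusSite d L × Fin d) : ℝ :=
  (conj c * (polyakov ρ U b.1 - polyakov ρ U (b.1 + Pi.single b.2 1))).re - (N / 2 : ℝ) * ‖c‖ ^ 2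

omit [NeZero L] in
/-- `shiftTerm` is `shiftTermC` at the coefficient `h b`. [folklore] -/
theorem shiftTerm_eq_shiftTermC (h : TorusSite d L × Fin d → ℂ) (U : Config d L G)
    (b : TorusSite d L × Fin d) : shiftTerm ρ h U b = shiftTermC ρ (h b) U b := rfl

/-- The sign of the reflected bond field: `-1` on `j`-bonds (orientation reversed by the
mirror), `+1` otherwise. [folklore] -/
def sgn (b : TorusSite d L × Fin d) : ℂ := if b.2 = j then -1 else 1

/-- **The reflected bond field** `θ*h`: `(θ*h)(b) = ± h(mirror bond)`. [cite: FriedliVelenik2017, §10.5.3, proof of Prop. 10.27] -/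
def pullField (h : TorusSite d L × Fin d → ℂ) : TorusSite d L × Fin d → ℂ :=
  fun b => sgn j b * h (bondMirror j k b)

omit [NeZero L] in
/-- The sign is the same for a bond and its mirror. [folklore] -/
theorem sgn_bondMirror (b : TorusSite d L × Fin d) : sgn j (bondMirror j k b) = sgn j b := rfl

omit [NeZero L] in
/-- `sgn² = 1`. [folklore] -/
theorem sgn_mul_sgn (b : TorusSite d L × Fin d) : sgn j b * sgn j b = 1 := by
  unfold sgn; split_ifs <;> norm_num

omit [NeZero L] in
/-- `|sgn| = 1`. [folklore] -/
theorem norm_sgn (b : TorusSite d L × Fin d) : ‖sgn j b‖ = 1 := by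
  unfold sgn; split_ifs <;> simp

omit [NeZero L] in
/-- `θ*` is an involution. [folklore] -/
theorem pullField_pullField (h : TorusSite d L × Fin d → ℂ) :
    pullField j k (pullField j k h) = h := by
  funext b
  simp only [pullField, sgn_bondMirror, bondMirror_bondMirror, ← mul_assoc, sgn_mul_sgn, one_mul]

/-! #### Covariance of the local terms under `Θ` -/

omit [NeZero L] in
/-- Electric terms: `eRe(ΘU, b) = eRe(U, mirror b)`. [folklore] -/
theorem eRe_reflect (hρu : ∀ g, ρ g ∈ Matrix.unitaryGroup (Fin N) ℂ) (U : Config d L G)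
    (b : TorusSite d L × Fin d) : eRe ρ (reflect j k U) b = eRe ρ U (bondMirror j k b) := by
  unfold eRe
  rw [trace_re_eplaq_reflect j k ρ hρu]
  rfl

omit [NeZero L] in
/-- Shift terms: `shiftTermC c (ΘU) b = shiftTermC (± c) U (mirror b)`. [folklore] -/
theorem shiftTermC_reflect (c : ℂ) (U : Config d L G) (b : TorusSite d L × Fin d) :
    shiftTermC ρ c (reflect j k U) b = shiftTermC ρ (sgn j b * c) U (bondMirror j k b) := by
  rcases b with ⟨x, i⟩
  unfold shiftTermC
  simp only [polyakov_reflect]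
  by_cases hi : i = j
  · subst hi
    simp only [sgn, bondMirror, if_true, mirror_add_single_self, sub_add_cancel, norm_mul,
      norm_neg, norm_one, one_mul, map_mul, map_neg, map_one]
    congr 1
    ring_nf
  · simp only [sgn, bondMirror, hi, if_false, mirror_add_single_of_ne j k hi, one_mul]

omit [NeZero L] in
/-- Magnetic terms: `mRe(ΘU, q) = mRe(U, mirror q)`. [folklore] -/
theorem mRe_reflect (hρu : ∀ g, ρ g ∈ Matrix.unitaryGroup (Fin N) ℂ) (U : Config d L G)
    (q : Plaq d L) : mRe ρ (reflect j k U) q = mRe ρ U (plaqMirror j k q) := by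
  unfold mRe
  rw [trace_re_mplaq_reflect j k ρ hρu U q.1 (ne_of_lt q.2.2)]
  rfl

/-! #### The positive endpoint of a crossing bond, the half functional and the features -/

/-- The positive endpoint of the crossing bond at `x` (`n(x) ∈ {0, L/2}`): `x` itself if
`n(x) = L/2`, else `x + e_j`. [folklore] -/
def yplus (x : TorusSite d L) : TorusSite d L := if jv j k x = L / 2 then x else x + Pi.single j 1

/-- The orientation sign of the crossing bond at `x`: `+1` if its tail is positive. [folklore] -/
def eps (x : TorusSite d L) : ℂ := if jv j k x = L / 2 then 1 else -1

/-- The constant attached to the positive endpoint of the crossing bond `b`: `c₊ = -ε h_b / 2`. [cite: FriedliVelenik2017, §10.5.3, proof of Prop. 10.27] -/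
def cplus (g : TorusSite d L × Fin d → ℂ) (b : TorusSite d L × Fin d) : ℂ := -(eps j k b.1) * g b / 2

/-- `ρ(u_{y₊})`. [folklore] -/
def Aplus (U : Config d L G) (x : TorusSite d L) : Matrix (Fin N) (Fin N) ℂ :=
  ρ (U (yplus j k x, none))

/-- The direction other than `j` of a plaquette touching `j`. [folklore] -/
def odir (q : Plaq d L) : Fin d := if q.2.1.1 = j then q.2.1.2 else q.2.1.1

/-- `ρ` of the positive spatial link of a crossing plaquette. [folklore] -/
def Bplus (U : Config d L G) (q : Plaq d L) : Matrix (Fin N) (Fin N) ℂ :=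
  ρ (U (yplus j k q.1, some (odir j q)))

/-- The crossing bonds as a `Finset`. [folklore] -/
abbrev crossBonds : Finset (TorusSite d L × Fin d) := Finset.univ.filter (IsCrossBond j k)

/-- The crossing plaquettes as a `Finset`. [folklore] -/
abbrev crossPlaqs : Finset (Plaq d L) := Finset.univ.filter (IsCrossPlaq j k)

variable (JE JM : ℝ)

/-- **The half functional `𝒜_g`**: the electric bonds (with their shifts) and the magnetic
plaquettes of the positive half, and the single-site pieces `-(J_E/2)‖ρ(u_{y₊}) + c₊‖²` of the
crossing bonds (Friedli–Velenik's `A` of the proof of Prop. 10.27). [cite: FriedliVelenik2017, §10.5.3, proof of Prop. 10.27] -/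
def halfExp (g : TorusSite d L × Fin d → ℂ) (U : Config d L G) : ℝ :=
  JE * ∑ b ∈ Finset.univ.filter (IsPosBond j k), (eRe ρ U b + shiftTerm ρ g U b) +
  JM * ∑ q ∈ Finset.univ.filter (IsPosPlaq j k), mRe ρ U q -
  JE / 2 * ∑ b ∈ crossBonds j k, hsNormSq (Aplus ρ j k U b.1 + cplus j k g b • 1)

/-- The index set of the crossing features: (crossing bond or crossing plaquette) × matrix entry ×
(real or imaginary part). [folklore] -/
abbrev Feat (d L N : ℕ) (j : Fin d) (k : ZMod L) [NeZero L] : Type :=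
  (↥(crossBonds (d := d) (L := L) j k) × (Fin N × Fin N) × Bool) ⊕
    (↥(crossPlaqs (d := d) (L := L) j k) × (Fin N × Fin N) × Bool)

/-- Real or imaginary part. [folklore] -/
def cpt (s : Bool) (z : ℂ) : ℝ := if s then z.re else z.im

/-- **The crossing features `p^g_c`**: `√J_E ·` (real/imaginary parts of the entries of
`ρ(u_{y₊}) + c₊(g)`) for the crossing bonds, `√J_M ·` (those of the positive spatial link) for the
crossing plaquettes. [cite: FriedliVelenik2017, §10.5.3, proof of Prop. 10.27 (the `C_i`, `D_i`)] -/
def feat (g : TorusSite d L × Fin d → ℂ) : Feat d L N j k → Config d L G → ℝ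
  | Sum.inl ⟨b, a, s⟩, U =>
      Real.sqrt JE * cpt s ((Aplus ρ j k U b.1.1 + cplus j k g b.1 • 1) a.1 a.2)
  | Sum.inr ⟨q, a, s⟩, U => Real.sqrt JM * cpt s ((Bplus ρ j k U q.1) a.1 a.2)

omit [NeZero L] in
/-- The feature form of `reInner`. [folklore] -/
theorem sum_cpt_mul_cpt (X Y : Matrix (Fin N) (Fin N) ℂ) :
    ∑ a : Fin N × Fin N, ∑ s : Bool, cpt s (X a.1 a.2) * cpt s (Y a.1 a.2) = reInner X Y := by
  rw [reInner, Fintype.sum_prod_type]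
  refine Finset.sum_congr rfl fun a _ => Finset.sum_congr rfl fun b _ => ?_
  rw [Fintype.sum_bool]
  simp [cpt]

/-- **The crossing kernel**:
`Σ_c p^{g₁}_c(U) p^{g₂}_c(V) = J_E Σ_{b cross} reInner(A⁺(U)+c₊(g₁), A⁺(V)+c₊(g₂)) + J_M Σ_{q cross} reInner(B⁺(U), B⁺(V))`.
[folklore] -/
theorem sum_feat_mul_feat (hJE : 0 ≤ JE) (hJM : 0 ≤ JM) (g₁ g₂ : TorusSite d L × Fin d → ℂ)
    (U V : Config d L G) :
    ∑ c, feat ρ j k JE JM g₁ c U * feat ρ j k JE JM g₂ c V =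
      JE * ∑ b ∈ crossBonds j k,
        reInner (Aplus ρ j k U b.1 + cplus j k g₁ b • 1) (Aplus ρ j k V b.1 + cplus j k g₂ b • 1) +
      JM * ∑ q ∈ crossPlaqs j k, reInner (Bplus ρ j k U q) (Bplus ρ j k V q) := by
  rw [Fintype.sum_sum_type]
  congr 1
  · rw [Fintype.sum_prod_type, Finset.mul_sum, ← Finset.sum_coe_sort (crossBonds j k)]
    refine Finset.sum_congr rfl fun b _ => ?_
    rw [Fintype.sum_prod_type, ← sum_cpt_mul_cpt, Finset.mul_sum]
    refine Finset.sum_congr rfl fun a _ => ?_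
    rw [Finset.mul_sum]
    refine Finset.sum_congr rfl fun s _ => ?_
    simp only [feat]
    rw [show Real.sqrt JE * cpt s ((Aplus ρ j k U b.1.1 + cplus j k g₁ b.1 • 1) a.1 a.2) *
        (Real.sqrt JE * cpt s ((Aplus ρ j k V b.1.1 + cplus j k g₂ b.1 • 1) a.1 a.2)) =
        (Real.sqrt JE * Real.sqrt JE) * (cpt s ((Aplus ρ j k U b.1.1 + cplus j k g₁ b.1 • 1) a.1 a.2) *
          cpt s ((Aplus ρ j k V b.1.1 + cplus j k g₂ b.1 • 1) a.1 a.2)) by ring,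
      Real.mul_self_sqrt hJE]
  · rw [Fintype.sum_prod_type, Finset.mul_sum, ← Finset.sum_coe_sort (crossPlaqs j k)]
    refine Finset.sum_congr rfl fun q _ => ?_
    rw [Fintype.sum_prod_type, ← sum_cpt_mul_cpt, Finset.mul_sum]
    refine Finset.sum_congr rfl fun a _ => ?_
    rw [Finset.mul_sum]
    refine Finset.sum_congr rfl fun s _ => ?_
    simp only [feat]
    rw [show Real.sqrt JM * cpt s ((Bplus ρ j k U q.1) a.1 a.2) *
        (Real.sqrt JM * cpt s ((Bplus ρ j k V q.1) a.1 a.2)) =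
        (Real.sqrt JM * Real.sqrt JM) * (cpt s ((Bplus ρ j k U q.1) a.1 a.2) *
          cpt s ((Bplus ρ j k V q.1) a.1 a.2)) by ring,
      Real.mul_self_sqrt hJM]

end Split

/-! ### The splitting of the integrand of `Z(h)` along the mirror -/

section SplitProof

variable {d L : ℕ} {G : Type*} [Group G] {N : ℕ} (ρ : G →* Matrix (Fin N) (Fin N) ℂ)
  (j : Fin d) (k : ZMod L) [NeZero L] (JE JM : ℝ)

omit [NeZero L] in
/-- The action as a sum over bonds and plaquettes. [folklore] -/
theorem minusAction_eq_sum [NeZero L] (U : Config d L G) :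
    minusAction ρ JE JM U = JE * ∑ b : TorusSite d L × Fin d, eRe ρ U b + JM * ∑ q : Plaq d L, mRe ρ U q := by
  unfold minusAction eRe mRe
  rw [Fintype.sum_prod_type, Fintype.sum_prod_type]

/-- A crossing `j`-link. [folklore] -/
theorem mem_crossLinks_of_jv {x : TorusSite d L} (hx : jv j k x = 0 ∨ jv j k x = L / 2) :
    ((x, some j) : Link d L) ∈ crossLinks j k :=
  (mem_crossLinks j k _).2 ⟨rfl, hx⟩

/-- The parallel crossing `j`-link one step away in a direction `i ≠ j`. [folklore] -/
theorem mem_crossLinks_add_of_jv {x : TorusSite d L} (hx : jv j k x = 0 ∨ jv j k x = L / 2)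
    {i : Fin d} (hi : i ≠ j) : ((x + Pi.single i 1, some j) : Link d L) ∈ crossLinks j k :=
  (mem_crossLinks j k _).2 ⟨rfl, by simp only; rw [jv_add_single_of_ne j k hi]; exact hx⟩

omit [NeZero L] in
/-- `Re tr(X Yᴴ) = Re tr(Y Xᴴ)`. [folklore] -/
theorem trace_mul_conjTranspose_re_comm (X Y : Matrix (Fin N) (Fin N) ℂ) :
    (X * Y.conjTranspose).trace.re = (Y * X.conjTranspose).trace.re := by
  rw [← reInner_eq_trace_re, ← reInner_eq_trace_re, reInner_comm]

/-- `θ*h = -h` on crossing bonds. [folklore] -/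
theorem pullField_of_isCrossBond (hL : Even L) (h : TorusSite d L × Fin d → ℂ)
    {b : TorusSite d L × Fin d} (hb : IsCrossBond j k b) : pullField j k h b = -h b := by
  rw [pullField, bondMirror_of_isCrossBond j k hL hb, sgn, if_pos hb.1]
  ring

/-- **The crossing electric bond splits** (the completed square): for a configuration with the
crossing `j`-links equal to `1` and a crossing bond `b`,
`J_E (eRe b + shiftTerm h b) = -(J_E/2)‖A⁺ + c₊(h)‖² - (J_E/2)‖A⁺∘Θ + c₊(θ*h)‖² + J_E reInner(A⁺ + c₊(h), A⁺∘Θ + c₊(θ*h)) + J_E N`.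
[cite: FriedliVelenik2017, §10.5.3, proof of Prop. 10.27] -/
theorem crossBond_split (hL : Even L) (hρu : ∀ g, ρ g ∈ Matrix.unitaryGroup (Fin N) ℂ)
    (h : TorusSite d L × Fin d → ℂ) (V : Config d L G) (hV : ∀ e ∈ crossLinks j k, V e = 1)
    {b : TorusSite d L × Fin d} (hb : IsCrossBond j k b) :
    JE * (eRe ρ V b + shiftTerm ρ h V b) =
      -(JE / 2) * hsNormSq (Aplus ρ j k V b.1 + cplus j k h b • 1) -
        JE / 2 * hsNormSq (Aplus ρ j k (reflect j k V) b.1 + cplus j k (pullField j k h) b • 1) +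
        JE * reInner (Aplus ρ j k V b.1 + cplus j k h b • 1)
          (Aplus ρ j k (reflect j k V) b.1 + cplus j k (pullField j k h) b • 1) + JE * N := by
  have hci := crossing_identity (hρu (V (yplus j k b.1, none)))
    (hρu (reflect j k V (yplus j k b.1, none))) (cplus j k h b) (cplus j k (pullField j k h) b)
  -- it suffices to identify the right-hand side of the completed square
  suffices hkey : eRe ρ V b + shiftTerm ρ h V b =
      (ρ (V (yplus j k b.1, none)) * (ρ (reflect j k V (yplus j k b.1, none))).conjTranspose).trace.re +
      (conj (cplus j k (pullField j k h) b - cplus j k h b) *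
        ((ρ (V (yplus j k b.1, none))).trace - (ρ (reflect j k V (yplus j k b.1, none))).trace)).re -
      (N / 2 : ℝ) * ‖cplus j k (pullField j k h) b - cplus j k h b‖ ^ 2 by
    rw [hkey]
    unfold Aplus
    linear_combination (-JE) * hci
  rcases b with ⟨x, i⟩
  obtain ⟨hi, hx⟩ := hb
  simp only at hi hx
  subst hi
  have hpull : pullField i k h (x, i) = -h (x, i) := pullField_of_isCrossBond i k hL h ⟨rfl, hx⟩
  have hV1 : V (x, some i) = 1 := hV _ (mem_crossLinks_of_jv i k hx)
  have hS : ∀ (c a b : ℂ), (conj c * (a - b)).re = (conj (-c) * (b - a)).re := fun c a b => by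
    rw [map_neg]; congr 1; ring
  rcases hx with hx | hx
  · -- lower crossing bond: the head `x + e_j` is positive
    have hne : jv i k x ≠ L / 2 := by
      have := NeZero.ne L; obtain ⟨M, hM⟩ := hL; omega
    have hy : yplus i k x = x + Pi.single i 1 := by simp [yplus, hne]
    have hε : eps i k x = -1 := by simp [eps, hne]
    have hc : cplus i k (pullField i k h) (x, i) - cplus i k h (x, i) = -h (x, i) := by
      rw [cplus, cplus, hpull, hε]; ring
    rw [hc, hy]
    simp only [reflect_none, mirror_add_single_eq_of_jv i k hx]
    unfold eRe shiftTerm eplaq polyakov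
    simp only [hV1, mul_one, inv_one, map_mul, rep_inv_eq_conjTranspose ρ hρu, norm_neg]
    rw [trace_mul_conjTranspose_re_comm, hS]
    ring
  · -- upper crossing bond: the tail `x` is positive
    have hy : yplus i k x = x := by simp [yplus, hx]
    have hε : eps i k x = 1 := by simp [eps, hx]
    have hc : cplus i k (pullField i k h) (x, i) - cplus i k h (x, i) = h (x, i) := by
      rw [cplus, cplus, hpull, hε]; ring
    rw [hc, hy]
    simp only [reflect_none, mirror_eq_add_single_of_jv i k hL hx]
    unfold eRe shiftTerm eplaq polyakov
    simp only [hV1, mul_one, inv_one, map_mul, rep_inv_eq_conjTranspose ρ hρu]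
    ring

/-- **The crossing magnetic plaquettes**: for a configuration with the crossing `j`-links equal
to `1` and a crossing plaquette `q`, `mRe q = reInner(B⁺, B⁺∘Θ)`. [cite: BorgsSeiler1983, §II.2 (pp. 331–332)] -/
theorem crossPlaq_split (hL : Even L) (hρu : ∀ g, ρ g ∈ Matrix.unitaryGroup (Fin N) ℂ)
    (V : Config d L G) (hV : ∀ e ∈ crossLinks j k, V e = 1) {q : Plaq d L}
    (hq : IsCrossPlaq j k q) :
    mRe ρ V q = reInner (Bplus ρ j k V q) (Bplus ρ j k (reflect j k V) q) := by
  rcases q with ⟨x, ⟨⟨a, b⟩, hab⟩⟩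
  obtain ⟨ht, hx⟩ := hq
  simp only [touchesJ] at ht hx
  have hyε : (jv j k x = 0 → yplus j k x = x + Pi.single j 1) ∧
      (jv j k x = L / 2 → yplus j k x = x) := by
    constructor
    · intro h0
      have hne : jv j k x ≠ L / 2 := by
        have := NeZero.ne L; obtain ⟨M, hM⟩ := hL; omega
      simp [yplus, hne]
    · intro h2; simp [yplus, h2]
  rw [reInner_eq_trace_re]
  unfold mRe Bplus mplaq
  simp only [odir]
  rcases ht with ht | ht
  · -- `a = j`
    subst ht
    have hb : b ≠ a := ne_of_gt hab
    have h1 : V (x, some a) = 1 := hV _ (mem_crossLinks_of_jv a k hx)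
    have h2 : V (x + Pi.single b 1, some a) = 1 := hV _ (mem_crossLinks_add_of_jv a k hx hb)
    simp only [if_true, h1, h2, one_mul, inv_one, mul_one, map_mul,
      rep_inv_eq_conjTranspose ρ hρu, reflect_of_ne a k _ hb]
    rcases hx with hx | hx
    · rw [hyε.1 hx, mirror_add_single_eq_of_jv a k hx]
    · rw [hyε.2 hx, mirror_eq_add_single_of_jv a k hL hx, trace_mul_conjTranspose_re_comm]
  · -- `b = j`
    subst ht
    have ha : a ≠ b := ne_of_lt hab
    have h1 : V (x, some b) = 1 := hV _ (mem_crossLinks_of_jv b k hx)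
    have h2 : V (x + Pi.single a 1, some b) = 1 := hV _ (mem_crossLinks_add_of_jv b k hx ha)
    simp only [ha, if_false, h1, h2, mul_one, inv_one, map_mul,
      rep_inv_eq_conjTranspose ρ hρu, reflect_of_ne b k _ ha]
    rcases hx with hx | hx
    · rw [hyε.1 hx, mirror_add_single_eq_of_jv b k hx, trace_mul_conjTranspose_re_comm]
    · rw [hyε.2 hx, mirror_eq_add_single_of_jv b k hL hx]

omit [NeZero L] in
/-- **The negative bonds are the reflected positive bonds**:
`eRe(V, mirror b) + shiftTerm(h, V, mirror b) = eRe(ΘV, b) + shiftTerm(θ*h, ΘV, b)`. [folklore] -/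
theorem mirrorBond_eq (hρu : ∀ g, ρ g ∈ Matrix.unitaryGroup (Fin N) ℂ) (h : TorusSite d L × Fin d → ℂ)
    (V : Config d L G) (b : TorusSite d L × Fin d) :
    eRe ρ V (bondMirror j k b) + shiftTerm ρ h V (bondMirror j k b) =
      eRe ρ (reflect j k V) b + shiftTerm ρ (pullField j k h) (reflect j k V) b := by
  rw [eRe_reflect ρ j k hρu, shiftTerm_eq_shiftTermC, shiftTerm_eq_shiftTermC, shiftTermC_reflect,
    pullField, ← mul_assoc, sgn_mul_sgn, one_mul]

omit [NeZero L] in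
/-- **The negative plaquettes are the reflected positive plaquettes.** [folklore] -/
theorem mirrorPlaq_eq (hρu : ∀ g, ρ g ∈ Matrix.unitaryGroup (Fin N) ℂ) (V : Config d L G)
    (q : Plaq d L) : mRe ρ V (plaqMirror j k q) = mRe ρ (reflect j k V) q :=
  (mRe_reflect ρ j k hρu V q).symm

/-- **The exponent of `Z(h)` split along the mirror** (Friedli–Velenik 2017, proof of
Prop. 10.27, `-β Σ‖…‖² = A + Θ(B) + Σ C_i Θ(D_i)`, for the lattice gauge theory in the axial
gauge of the crossing links): for a configuration `V` with all crossing `j`-links equal to `1`,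
`-S(V) + J_E Σ_b shiftTerm(h, V, b) = 𝒜_h(V) + 𝒜_{θ*h}(ΘV) + Σ_c p^h_c(V) p^{θ*h}_c(ΘV) + J_E N #(crossing bonds)`.
[cite: FriedliVelenik2017, §10.5.3, proof of Prop. 10.27] -/
theorem exponent_split (hL : Even L) (hL4 : 4 ≤ L) (hρu : ∀ g, ρ g ∈ Matrix.unitaryGroup (Fin N) ℂ)
    (hJE : 0 ≤ JE) (hJM : 0 ≤ JM) (h : TorusSite d L × Fin d → ℂ) (V : Config d L G)
    (hV : ∀ e ∈ crossLinks j k, V e = 1) :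
    minusAction ρ JE JM V + JE * ∑ b : TorusSite d L × Fin d, shiftTerm ρ h V b =
      halfExp ρ j k JE JM h V + halfExp ρ j k JE JM (pullField j k h) (reflect j k V) +
        ∑ c, feat ρ j k JE JM h c V * feat ρ j k JE JM (pullField j k h) c (reflect j k V) +
        JE * N * (crossBonds j k).card := by
  rw [minusAction_eq_sum, sum_feat_mul_feat ρ j k JE JM hJE hJM]
  have hcomb : JE * ∑ b : TorusSite d L × Fin d, eRe ρ V b + JM * ∑ q : Plaq d L, mRe ρ V q +
      JE * ∑ b : TorusSite d L × Fin d, shiftTerm ρ h V b =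
      JE * ∑ b : TorusSite d L × Fin d, (eRe ρ V b + shiftTerm ρ h V b) +
        JM * ∑ q : Plaq d L, mRe ρ V q := by
    rw [Finset.sum_add_distrib]; ring
  rw [hcomb, sum_bond_split j k hL hL4 (fun b => eRe ρ V b + shiftTerm ρ h V b),
    sum_plaq_split j k hL hL4 (fun q => mRe ρ V q)]
  -- the mirror sums are the reflected positive sums
  have hmb : ∑ b ∈ Finset.univ.filter (IsPosBond j k),
      (eRe ρ V (bondMirror j k b) + shiftTerm ρ h V (bondMirror j k b)) =
      ∑ b ∈ Finset.univ.filter (IsPosBond j k),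
        (eRe ρ (reflect j k V) b + shiftTerm ρ (pullField j k h) (reflect j k V) b) :=
    Finset.sum_congr rfl fun b _ => mirrorBond_eq ρ j k hρu h V b
  have hmq : ∑ q ∈ Finset.univ.filter (IsPosPlaq j k), mRe ρ V (plaqMirror j k q) =
      ∑ q ∈ Finset.univ.filter (IsPosPlaq j k), mRe ρ (reflect j k V) q :=
    Finset.sum_congr rfl fun q _ => mirrorPlaq_eq ρ j k hρu V q
  -- the crossing sums
  have hcb : JE * ∑ b ∈ crossBonds j k, (eRe ρ V b + shiftTerm ρ h V b) =
      -(JE / 2) * ∑ b ∈ crossBonds j k, hsNormSq (Aplus ρ j k V b.1 + cplus j k h b • 1) -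
      JE / 2 * ∑ b ∈ crossBonds j k,
        hsNormSq (Aplus ρ j k (reflect j k V) b.1 + cplus j k (pullField j k h) b • 1) +
      JE * ∑ b ∈ crossBonds j k, reInner (Aplus ρ j k V b.1 + cplus j k h b • 1)
          (Aplus ρ j k (reflect j k V) b.1 + cplus j k (pullField j k h) b • 1) +
      JE * N * (crossBonds j k).card := by
    rw [Finset.mul_sum]
    rw [Finset.sum_congr rfl fun b hb =>
      crossBond_split ρ j k JE hL hρu h V hV ((Finset.mem_filter.1 hb).2)]
    simp only [Finset.sum_add_distrib, Finset.sum_sub_distrib, Finset.sum_const, nsmul_eq_mul,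
      ← Finset.mul_sum]
    ring
  have hcq : JM * ∑ q ∈ crossPlaqs j k, mRe ρ V q =
      JM * ∑ q ∈ crossPlaqs j k, reInner (Bplus ρ j k V q) (Bplus ρ j k (reflect j k V) q) := by
    congr 1
    refine Finset.sum_congr rfl fun q hq => ?_
    exact crossPlaq_split ρ j k hL hρu V hV ((Finset.mem_filter.1 hq).2)
  rw [hmb, hmq]
  rw [show JE * (∑ b ∈ Finset.univ.filter (IsPosBond j k), (eRe ρ V b + shiftTerm ρ h V b) +
        ∑ b ∈ crossBonds j k, (eRe ρ V b + shiftTerm ρ h V b) +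
        ∑ b ∈ Finset.univ.filter (IsPosBond j k),
          (eRe ρ (reflect j k V) b + shiftTerm ρ (pullField j k h) (reflect j k V) b)) +
      JM * (∑ q ∈ Finset.univ.filter (IsPosPlaq j k), mRe ρ V q + ∑ q ∈ crossPlaqs j k, mRe ρ V q +
        ∑ q ∈ Finset.univ.filter (IsPosPlaq j k), mRe ρ (reflect j k V) q) =
      JE * ∑ b ∈ Finset.univ.filter (IsPosBond j k), (eRe ρ V b + shiftTerm ρ h V b) +
      JE * ∑ b ∈ Finset.univ.filter (IsPosBond j k),
          (eRe ρ (reflect j k V) b + shiftTerm ρ (pullField j k h) (reflect j k V) b) +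
      JM * ∑ q ∈ Finset.univ.filter (IsPosPlaq j k), mRe ρ V q +
      JM * ∑ q ∈ Finset.univ.filter (IsPosPlaq j k), mRe ρ (reflect j k V) q +
      JE * ∑ b ∈ crossBonds j k, (eRe ρ V b + shiftTerm ρ h V b) +
      JM * ∑ q ∈ crossPlaqs j k, mRe ρ V q by ring, hcb, hcq]
  unfold halfExp
  ring

/-- **The integrand of `Z(h)` split along the mirror** (exponential form): for `V` with all
crossing `j`-links equal to `1`,
`zWeight h V = e^{J_E N #cross} · e^{𝒜_h(V)} · e^{𝒜_{θ*h}(ΘV)} · exp{Σ_c p^h_c(V) p^{θ*h}_c(ΘV)}`. [cite: FriedliVelenik2017, §10.5.3, proof of Prop. 10.27] -/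
theorem zWeight_split (hL : Even L) (hL4 : 4 ≤ L) (hρu : ∀ g, ρ g ∈ Matrix.unitaryGroup (Fin N) ℂ)
    (hJE : 0 ≤ JE) (hJM : 0 ≤ JM) (h : TorusSite d L × Fin d → ℂ) (V : Config d L G)
    (hV : ∀ e ∈ crossLinks j k, V e = 1) :
    zWeight ρ JE JM h V =
      Real.exp (JE * N * (crossBonds j k).card) *
        (Real.exp (halfExp ρ j k JE JM h V) *
          Real.exp (halfExp ρ j k JE JM (pullField j k h) (reflect j k V)) *
          Real.exp (1 * ∑ c, feat ρ j k JE JM h c V * feat ρ j k JE JM (pullField j k h) c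
            (reflect j k V))) := by
  rw [zWeight_eq_exp, exponent_split ρ j k JE JM hL hL4 hρu hJE hJM h V hV, one_mul,
    ← Real.exp_add, ← Real.exp_add, ← Real.exp_add]
  congr 1
  ring

end SplitProof

/-! ### Dependence, continuity and bounds of the half functional and the features -/

section Regularity

variable {d L : ℕ} {G : Type*} [Group G] {N : ℕ} (ρ : G →* Matrix (Fin N) (Fin N) ℂ)
  (j : Fin d) (k : ZMod L) [NeZero L] (JE JM : ℝ)

omit [NeZero L] in
/-- Positive bonds are not crossing. [folklore] -/
theorem not_isCrossBond_of_isPosBond {b : TorusSite d L × Fin d} (hb : IsPosBond j k b) :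
    ¬ IsCrossBond j k b := by
  rintro ⟨h1, h2⟩
  obtain ⟨⟨h3, h4⟩, h5⟩ := hb
  have h6 := h5 h1
  omega

/-- Positive and crossing links are disjoint. [folklore] -/
theorem disjoint_posLinks_crossLinks : Disjoint (posLinks (d := d) j k) (crossLinks j k) := by
  rw [Finset.disjoint_left]
  rintro ⟨x, μ⟩ hp hc
  rw [mem_posLinks] at hp
  rw [mem_crossLinks] at hc
  obtain ⟨⟨h1, h2⟩, h3⟩ := hp
  obtain ⟨h4, h5⟩ := hc
  have h6 := h3 h4
  simp only at h1 h2 h5 h6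
  omega

/-- The crossing links are permuted by `reflLink`. [folklore] -/
theorem isCrossLink_reflLink (hL : Even L) (hL4 : 4 ≤ L) {e : Link d L} (he : IsCrossLink j k e) :
    IsCrossLink j k (reflLink j k e) := by
  obtain ⟨M, hM⟩ := hL
  rcases e with ⟨x, μ⟩
  obtain ⟨hμ, hx⟩ := he
  simp only at hμ hx
  subst hμ
  refine ⟨rfl, ?_⟩
  simp only [reflLink_self]
  have hm := jv_mirror j k (by omega) x
  have hs := jv_sub_single_self j k (mirror j k x)
  rw [hs]
  split_ifs at hm hs ⊢ with h1 h2 h3 <;> omega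

/-- `e` is crossing iff `reflLink e` is. [folklore] -/
theorem isCrossLink_reflLink_iff (hL : Even L) (hL4 : 4 ≤ L) (e : Link d L) :
    IsCrossLink j k (reflLink j k e) ↔ IsCrossLink j k e :=
  ⟨fun h => by simpa [reflLink_reflLink] using isCrossLink_reflLink j k hL hL4 h,
    isCrossLink_reflLink j k hL hL4⟩

/-- **`Θ` commutes with setting the crossing links to `1`.** [folklore] -/
theorem reflect_splice_one (hL : Even L) (hL4 : 4 ≤ L) (U : Config d L G) :
    reflect j k (splice (crossLinks j k) (U, 1)) = splice (crossLinks j k) (reflect j k U, 1) := by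
  funext e
  rw [reflect_apply, splice_apply, splice_apply]
  by_cases he : e ∈ crossLinks j k
  · have he' : reflLink j k e ∈ crossLinks j k :=
      (mem_crossLinks j k _).2 (isCrossLink_reflLink j k hL hL4 ((mem_crossLinks j k e).1 he))
    rw [if_pos he', if_pos he]
    simp [invIf]
  · have he' : reflLink j k e ∉ crossLinks j k := fun h =>
      he ((mem_crossLinks j k e).2 ((isCrossLink_reflLink_iff j k hL hL4 e).1 ((mem_crossLinks j k _).1 h)))
    rw [if_neg he', if_neg he]
    rfl

/-! #### Which links the terms depend on -/

/-- The far end of a positive bond is a positive site. [folklore] -/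
theorem isPosSite_add_of_isPosBond {b : TorusSite d L × Fin d} (hb : IsPosBond j k b) :
    IsPosSite j k (b.1 + Pi.single b.2 1) := by
  obtain ⟨⟨h1, h2⟩, h3⟩ := hb
  by_cases hi : b.2 = j
  · have h4 := h3 hi
    unfold IsPosSite
    rw [hi, jv_add_single_self]
    have := jv_lt j k b.1
    split_ifs with h5 <;> omega
  · unfold IsPosSite
    rw [jv_add_single_of_ne j k hi]
    exact ⟨h1, h2⟩

/-- A spatial link one step from a positive site, in a direction `c`, with the `j`-bond condition. [folklore] -/
theorem isPosLink_add_single {x : TorusSite d L} {a c : Fin d} (hx : IsPosSite j k x)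
    (hj : (a = j ∨ c = j) → jv j k x < L / 2) (hac : a ≠ c) :
    IsPosLink j k (x + Pi.single a 1, some c) := by
  obtain ⟨h1, h2⟩ := hx
  have hlt := jv_lt j k x
  constructor
  · unfold IsPosSite
    by_cases ha : a = j
    · have h4 := hj (Or.inl ha)
      rw [ha, jv_add_single_self]
      split_ifs with h5 <;> omega
    · rw [jv_add_single_of_ne j k ha]; exact ⟨h1, h2⟩
  · intro hc
    simp only [Option.some.injEq] at hc
    have ha : a ≠ j := fun h => hac (h.trans hc.symm)
    simp only
    rw [jv_add_single_of_ne j k ha]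
    exact hj (Or.inr hc)

/-- The positive endpoint of a crossing bond is a positive site. [folklore] -/
theorem isPosSite_yplus (hL : Even L) (hL4 : 4 ≤ L) {x : TorusSite d L}
    (hx : jv j k x = 0 ∨ jv j k x = L / 2) : IsPosSite j k (yplus j k x) := by
  obtain ⟨M, hM⟩ := hL
  unfold IsPosSite yplus
  have hlt := jv_lt j k x
  rcases hx with hx | hx
  · have hne : jv j k x ≠ L / 2 := by omega
    rw [if_neg hne, jv_add_single_self]
    split_ifs with h5 <;> omega
  · rw [if_pos hx, hx]
    omega

omit [NeZero L] in
/-- The other direction of a crossing plaquette is not `j`. [folklore] -/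
theorem odir_ne {q : Plaq d L} (hq : IsCrossPlaq j k q) : odir j q ≠ j := by
  obtain ⟨ht, -⟩ := hq
  have hne : q.2.1.1 ≠ q.2.1.2 := ne_of_lt q.2.2
  unfold odir
  split_ifs with h
  · rw [← h]; exact hne.symm
  · rcases ht with ht | ht
    · exact absurd ht h
    · exact h

variable {j k}

omit [Group G] in
/-- `DependsOn` on the positive block from a pointwise criterion. [folklore] -/
theorem dependsOn_posLinks_of {β : Type*} {f : Config d L G → β}
    (hf : ∀ U V : Config d L G, (∀ e, IsPosLink j k e → U e = V e) → f U = f V) :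
    DependsOn f ((posLinks j k : Finset (Link d L)) : Set (Link d L)) := fun U V hUV =>
  hf U V fun e he => hUV e (by rw [Finset.mem_coe, mem_posLinks]; exact he)

variable (j k)

/-- The electric term of a positive bond depends only on positive links. [folklore] -/
theorem eRe_congr_of_isPosBond {U V : Config d L G} (hUV : ∀ e, IsPosLink j k e → U e = V e)
    {b : TorusSite d L × Fin d} (hb : IsPosBond j k b) : eRe ρ U b = eRe ρ V b := by
  have h1 : IsPosLink j k (b.1, none) := ⟨hb.1, fun h => by cases h⟩
  have h2 : IsPosLink j k (b.1, some b.2) := ⟨hb.1, fun h => hb.2 (Option.some_injective _ h)⟩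
  have h3 : IsPosLink j k (b.1 + Pi.single b.2 1, none) :=
    ⟨isPosSite_add_of_isPosBond j k hb, fun h => by cases h⟩
  unfold eRe eplaq
  rw [hUV _ h1, hUV _ h2, hUV _ h3]

/-- The shift term of a positive bond depends only on positive links. [folklore] -/
theorem shiftTerm_congr_of_isPosBond (g : TorusSite d L × Fin d → ℂ) {U V : Config d L G}
    (hUV : ∀ e, IsPosLink j k e → U e = V e) {b : TorusSite d L × Fin d} (hb : IsPosBond j k b) :
    shiftTerm ρ g U b = shiftTerm ρ g V b := by
  have h1 : IsPosLink j k (b.1, none) := ⟨hb.1, fun h => by cases h⟩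
  have h3 : IsPosLink j k (b.1 + Pi.single b.2 1, none) :=
    ⟨isPosSite_add_of_isPosBond j k hb, fun h => by cases h⟩
  unfold shiftTerm polyakov
  rw [hUV _ h1, hUV _ h3]

/-- The magnetic term of a positive plaquette depends only on positive links. [folklore] -/
theorem mRe_congr_of_isPosPlaq {U V : Config d L G} (hUV : ∀ e, IsPosLink j k e → U e = V e)
    {q : Plaq d L} (hq : IsPosPlaq j k q) : mRe ρ U q = mRe ρ V q := by
  obtain ⟨hx, ht⟩ := hq
  have hab : q.2.1.1 ≠ q.2.1.2 := ne_of_lt q.2.2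
  have h1 : IsPosLink j k (q.1, some q.2.1.1) :=
    ⟨hx, fun h => ht (Or.inl (Option.some_injective _ h))⟩
  have h2 : IsPosLink j k (q.1, some q.2.1.2) :=
    ⟨hx, fun h => ht (Or.inr (Option.some_injective _ h))⟩
  have h3 : IsPosLink j k (q.1 + Pi.single q.2.1.1 1, some q.2.1.2) :=
    isPosLink_add_single j k hx (fun h => ht h) hab
  have h4 : IsPosLink j k (q.1 + Pi.single q.2.1.2 1, some q.2.1.1) :=
    isPosLink_add_single j k hx (fun h => ht h.symm) hab.symm
  unfold mRe mplaq
  rw [hUV _ h1, hUV _ h2, hUV _ h3, hUV _ h4]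

/-- `A⁺` of a crossing bond depends only on positive links. [folklore] -/
theorem Aplus_congr_of_isCrossBond (hL : Even L) (hL4 : 4 ≤ L) {U V : Config d L G}
    (hUV : ∀ e, IsPosLink j k e → U e = V e) {b : TorusSite d L × Fin d} (hb : IsCrossBond j k b) :
    Aplus ρ j k U b.1 = Aplus ρ j k V b.1 := by
  have h1 : IsPosLink j k (yplus j k b.1, none) := ⟨isPosSite_yplus j k hL hL4 hb.2, fun h => by cases h⟩
  unfold Aplus
  rw [hUV _ h1]

/-- `B⁺` of a crossing plaquette depends only on positive links. [folklore] -/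
theorem Bplus_congr_of_isCrossPlaq (hL : Even L) (hL4 : 4 ≤ L) {U V : Config d L G}
    (hUV : ∀ e, IsPosLink j k e → U e = V e) {q : Plaq d L} (hq : IsCrossPlaq j k q) :
    Bplus ρ j k U q = Bplus ρ j k V q := by
  have h1 : IsPosLink j k (yplus j k q.1, some (odir j q)) :=
    ⟨isPosSite_yplus j k hL hL4 hq.2, fun h => absurd (Option.some_injective _ h) (odir_ne j k hq)⟩
  unfold Bplus
  rw [hUV _ h1]

/-- **The half functional depends only on the positive links.** [folklore] -/
theorem dependsOn_halfExp (hL : Even L) (hL4 : 4 ≤ L) (g : TorusSite d L × Fin d → ℂ) :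
    DependsOn (halfExp ρ j k JE JM g) ((posLinks j k : Finset (Link d L)) : Set (Link d L)) := by
  refine dependsOn_posLinks_of fun U V hUV => ?_
  have h1 : ∑ b ∈ Finset.univ.filter (IsPosBond j k), (eRe ρ U b + shiftTerm ρ g U b) =
      ∑ b ∈ Finset.univ.filter (IsPosBond j k), (eRe ρ V b + shiftTerm ρ g V b) :=
    Finset.sum_congr rfl fun b hb => by
      rw [eRe_congr_of_isPosBond ρ j k hUV (Finset.mem_filter.1 hb).2,
        shiftTerm_congr_of_isPosBond ρ j k g hUV (Finset.mem_filter.1 hb).2]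
  have h2 : ∑ q ∈ Finset.univ.filter (IsPosPlaq j k), mRe ρ U q =
      ∑ q ∈ Finset.univ.filter (IsPosPlaq j k), mRe ρ V q :=
    Finset.sum_congr rfl fun q hq => mRe_congr_of_isPosPlaq ρ j k hUV (Finset.mem_filter.1 hq).2
  have h3 : ∑ b ∈ crossBonds j k, hsNormSq (Aplus ρ j k U b.1 + cplus j k g b • 1) =
      ∑ b ∈ crossBonds j k, hsNormSq (Aplus ρ j k V b.1 + cplus j k g b • 1) :=
    Finset.sum_congr rfl fun b hb => by
      rw [Aplus_congr_of_isCrossBond ρ j k hL hL4 hUV (Finset.mem_filter.1 hb).2]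
  unfold halfExp
  rw [h1, h2, h3]

/-- **The features depend only on the positive links.** [folklore] -/
theorem dependsOn_feat (hL : Even L) (hL4 : 4 ≤ L) (g : TorusSite d L × Fin d → ℂ) (c : Feat d L N j k) :
    DependsOn (feat ρ j k JE JM g c) ((posLinks j k : Finset (Link d L)) : Set (Link d L)) := by
  refine dependsOn_posLinks_of fun U V hUV => ?_
  rcases c with ⟨b, a, s⟩ | ⟨q, a, s⟩
  · simp only [feat]
    rw [Aplus_congr_of_isCrossBond ρ j k hL hL4 hUV (Finset.mem_filter.1 b.2).2]
  · simp only [feat]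
    rw [Bplus_congr_of_isCrossPlaq ρ j k hL hL4 hUV (Finset.mem_filter.1 q.2).2]

/-! #### Continuity and bounds -/

variable [TopologicalSpace G] [IsTopologicalGroup G] [CompactSpace G]

omit [Group G] [NeZero L] [IsTopologicalGroup G] [CompactSpace G] in
/-- The Hilbert–Schmidt norm of a continuous matrix function is continuous. [folklore] -/
theorem continuous_hsNormSq_comp {f : Config d L G → Matrix (Fin N) (Fin N) ℂ} (hf : Continuous f) :
    Continuous fun U => hsNormSq (f U) := by
  unfold hsNormSq
  exact continuous_finsetSum _ fun a _ => continuous_finsetSum _ fun b _ =>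
    ((hf.matrix_elem a b).norm).pow 2

omit [NeZero L] [IsTopologicalGroup G] [CompactSpace G] in
/-- `A⁺` is continuous. [folklore] -/
theorem continuous_Aplus (hρ : Continuous ρ) (x : TorusSite d L) :
    Continuous fun U : Config d L G => Aplus ρ j k U x :=
  hρ.comp (continuous_link _)

omit [NeZero L] [IsTopologicalGroup G] [CompactSpace G] in
/-- `B⁺` is continuous. [folklore] -/
theorem continuous_Bplus (hρ : Continuous ρ) (q : Plaq d L) :
    Continuous fun U : Config d L G => Bplus ρ j k U q :=
  hρ.comp (continuous_link _)

omit [CompactSpace G] in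
/-- The half functional is continuous. [folklore] -/
theorem continuous_halfExp (hρ : Continuous ρ) (g : TorusSite d L × Fin d → ℂ) :
    Continuous (halfExp (G := G) ρ j k JE JM g) := by
  unfold halfExp
  refine ((continuous_const.mul (continuous_finsetSum _ fun b _ => ?_)).add
    (continuous_const.mul (continuous_finsetSum _ fun q _ => ?_))).sub
    (continuous_const.mul (continuous_finsetSum _ fun b _ => ?_))
  · exact (continuous_trace_re ρ hρ (continuous_eplaq _ _)).add (continuous_shiftTerm ρ hρ g b)
  · exact continuous_trace_re ρ hρ (continuous_mplaq _ _ _)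
  · exact continuous_hsNormSq_comp ((continuous_Aplus ρ j k hρ _).add continuous_const)

omit [Group G] [NeZero L] [IsTopologicalGroup G] [CompactSpace G] in
/-- `cpt` of an entry of a continuous matrix function is continuous. [folklore] -/
theorem continuous_cpt_comp {f : Config d L G → Matrix (Fin N) (Fin N) ℂ} (hf : Continuous f)
    (s : Bool) (a b : Fin N) : Continuous fun U => cpt s (f U a b) := by
  cases s
  · exact Complex.continuous_im.comp (hf.matrix_elem a b)
  · exact Complex.continuous_re.comp (hf.matrix_elem a b)

omit [IsTopologicalGroup G] [CompactSpace G] in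
/-- The features are continuous. [folklore] -/
theorem continuous_feat (hρ : Continuous ρ) (g : TorusSite d L × Fin d → ℂ) (c : Feat d L N j k) :
    Continuous (feat (G := G) ρ j k JE JM g c) := by
  rcases c with ⟨b, a, s⟩ | ⟨q, a, s⟩
  · exact continuous_const.mul (continuous_cpt_comp ((continuous_Aplus ρ j k hρ _).add
      continuous_const) s a.1 a.2)
  · exact continuous_const.mul (continuous_cpt_comp (continuous_Bplus ρ j k hρ _) s a.1 a.2)

omit [Group G] [NeZero L] [IsTopologicalGroup G] in
/-- A continuous real function on the compact configuration space is bounded. [folklore] -/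
theorem exists_abs_le_of_continuous {f : Config d L G → ℝ} (hf : Continuous f) :
    ∃ R : ℝ, 0 ≤ R ∧ ∀ U, |f U| ≤ R := by
  obtain ⟨R, hR⟩ := (isCompact_range hf).isBounded.subset_closedBall 0
  refine ⟨max R 0, le_max_right _ _, fun U => ?_⟩
  have h := hR (Set.mem_range_self U)
  rw [Metric.mem_closedBall, dist_zero_right, Real.norm_eq_abs] at h
  exact h.trans (le_max_left _ _)

omit [Group G] [NeZero L] [IsTopologicalGroup G] in
/-- A common bound for finitely many continuous real functions. [folklore] -/
theorem exists_abs_le_of_continuous_family {κ : Type*} [Fintype κ] {f : κ → Config d L G → ℝ}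
    (hf : ∀ c, Continuous (f c)) : ∃ R : ℝ, 0 ≤ R ∧ ∀ c U, |f c U| ≤ R := by
  choose R hR0 hR using fun c => exists_abs_le_of_continuous (hf c)
  refine ⟨∑ c, R c, Finset.sum_nonneg fun c _ => hR0 c, fun c U => (hR c U).trans ?_⟩
  exact Finset.single_le_sum (f := R) (fun c _ => hR0 c) (Finset.mem_univ c)

end Regularity

/-! ### `Z(h)² ≤ Z(h⁺) Z(h⁻)` -/

section GaussianDominationCore

variable {d L : ℕ} {G : Type*} [Group G] {N : ℕ} (ρ : G →* Matrix (Fin N) (Fin N) ℂ)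
  (j : Fin d) (k : ZMod L) [NeZero L] (JE JM : ℝ)
  [TopologicalSpace G] [IsTopologicalGroup G] [CompactSpace G] [MeasurableSpace G] [BorelSpace G]
  [SecondCountableTopology G]

/-- **The two-half functional** `⟨e^{A + Θ(B) + Σ C Θ(D)}⟩`:
`pairZ(g₁, g₂) = ∫ e^{𝒜_{g₁}(U)} e^{𝒜_{g₂}(ΘU)} exp{Σ_c p^{g₁}_c(U) p^{g₂}_c(ΘU)} dμ`. [cite: FriedliVelenik2017, Lemma 10.28 and proof of Prop. 10.27] -/
def pairZ (g₁ g₂ : TorusSite d L × Fin d → ℂ) : ℝ :=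
  ∫ U, Real.exp (halfExp ρ j k JE JM g₁ U) * Real.exp (halfExp ρ j k JE JM g₂ (reflect j k U)) *
    Real.exp (1 * ∑ c, feat ρ j k JE JM g₁ c U * feat ρ j k JE JM g₂ c (reflect j k U))
    ∂piMeasure (ι := Link d L) (haarProbability G)

/-- **`Z(h) = e^{J_E N #cross} · pairZ(h, θ*h)`** (gauge fixing of the crossing links, the split of
the integrand, and the fact that `𝒜`, the features and `Θ` do not see the crossing links). [cite: FriedliVelenik2017, §10.5.3, proof of Prop. 10.27] -/
theorem gaussZ_eq_pairZ (hL : Even L) (hL4 : 4 ≤ L) (hρu : ∀ g, ρ g ∈ Matrix.unitaryGroup (Fin N) ℂ)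
    (hρ : Continuous ρ) (hJE : 0 ≤ JE) (hJM : 0 ≤ JM) (h : TorusSite d L × Fin d → ℂ) :
    gaussZ ρ JE JM h = Real.exp (JE * N * (crossBonds j k).card) * pairZ ρ j k JE JM h (pullField j k h) := by
  obtain ⟨K, -, hK⟩ := exists_abs_le_of_continuous (continuous_zWeight ρ hρ JE JM h (d := d) (L := L))
  unfold gaussZ pairZ
  rw [integral_eq_integral_splice_crossLinks_one j k hL hL4 (f := zWeight ρ JE JM h)
    (fun g U => zWeight_gaugeAct ρ JE JM h g U) (continuous_zWeight ρ hρ JE JM h).measurable hK,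
    ← integral_const_mul]
  refine integral_congr_ae (ae_of_all _ fun U => ?_)
  have hV : ∀ e ∈ crossLinks j k, splice (crossLinks j k) (U, (1 : Config d L G)) e = 1 := by
    intro e he; rw [splice_apply, if_pos he]; rfl
  dsimp only
  rw [zWeight_split ρ j k JE JM hL hL4 hρu hJE hJM h _ hV, reflect_splice_one j k hL hL4]
  have hdisj := disjoint_posLinks_crossLinks (d := d) j k
  have hA : ∀ (g : TorusSite d L × Fin d → ℂ) (W : Config d L G),
      halfExp ρ j k JE JM g (splice (crossLinks j k) (W, 1)) = halfExp ρ j k JE JM g W := fun g W =>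
    Literature.MathematicalPhysics.QuantumFieldTheory.LatticeRP.apply_splice_of_dependsOn_of_disjoint
      (dependsOn_halfExp ρ j k JE JM hL hL4 g) hdisj W 1
  have hF : ∀ (g : TorusSite d L × Fin d → ℂ) (c : Feat d L N j k) (W : Config d L G),
      feat ρ j k JE JM g c (splice (crossLinks j k) (W, 1)) = feat ρ j k JE JM g c W := fun g c W =>
    Literature.MathematicalPhysics.QuantumFieldTheory.LatticeRP.apply_splice_of_dependsOn_of_disjoint
      (dependsOn_feat ρ j k JE JM hL hL4 g c) hdisj W 1
  simp only [hA, hF]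

/-- **Lemma 10.28 for the two-half functional**: `pairZ(g₁,g₂)² ≤ pairZ(g₁,g₁) pairZ(g₂,g₂)`. [cite: FriedliVelenik2017, Lemma 10.28] -/
theorem pairZ_sq_le (hL : Even L) (hL4 : 4 ≤ L) (hρ : Continuous ρ) (g₁ g₂ : TorusSite d L × Fin d → ℂ) :
    pairZ ρ j k JE JM g₁ g₂ ^ 2 ≤ pairZ ρ j k JE JM g₁ g₁ * pairZ ρ j k JE JM g₂ g₂ := by
  -- a common bound for the (finitely many) continuous functions involved
  obtain ⟨R₁, h01, hR₁⟩ := exists_abs_le_of_continuous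
    (Real.continuous_exp.comp (continuous_halfExp ρ j k JE JM hρ g₁ (G := G)))
  obtain ⟨R₂, h02, hR₂⟩ := exists_abs_le_of_continuous
    (Real.continuous_exp.comp (continuous_halfExp ρ j k JE JM hρ g₂ (G := G)))
  obtain ⟨R₃, h03, hR₃⟩ := exists_abs_le_of_continuous_family
    (fun c => continuous_feat ρ j k JE JM hρ g₁ c (G := G))
  obtain ⟨R₄, h04, hR₄⟩ := exists_abs_le_of_continuous_family
    (fun c => continuous_feat ρ j k JE JM hρ g₂ c (G := G))
  set R := R₁ + R₂ + R₃ + R₄ with hR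
  unfold pairZ
  exact integral_mul_comp_mul_exp_sq_le (μ₀ := haarProbability G) (P := posLinks j k)
    (Θ := reflect j k) (measurePreserving_reflect j k) (reflect_apply_dependsOn j k hL hL4)
    zero_le_one (Φ := fun U => Real.exp (halfExp ρ j k JE JM g₁ U))
    (Ψ := fun U => Real.exp (halfExp ρ j k JE JM g₂ U))
    (p := feat ρ j k JE JM g₁) (q := feat ρ j k JE JM g₂)
    (Real.continuous_exp.comp (continuous_halfExp ρ j k JE JM hρ g₁)).measurable
    (Real.continuous_exp.comp (continuous_halfExp ρ j k JE JM hρ g₂)).measurable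
    (fun c => (continuous_feat ρ j k JE JM hρ g₁ c).measurable)
    (fun c => (continuous_feat ρ j k JE JM hρ g₂ c).measurable) (R := R) (by positivity)
    (fun U => (hR₁ U).trans (by linarith)) (fun U => (hR₂ U).trans (by linarith))
    (fun c U => (hR₃ c U).trans (by linarith)) (fun c U => (hR₄ c U).trans (by linarith))
    (fun U V hUV => congrArg Real.exp (dependsOn_halfExp ρ j k JE JM hL hL4 g₁ hUV))
    (fun U V hUV => congrArg Real.exp (dependsOn_halfExp ρ j k JE JM hL hL4 g₂ hUV))
    (dependsOn_feat ρ j k JE JM hL hL4 g₁) (dependsOn_feat ρ j k JE JM hL hL4 g₂)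

/-! #### The crossing values cancel on the diagonal -/

omit [NeZero L] [TopologicalSpace G] [IsTopologicalGroup G] [CompactSpace G] [MeasurableSpace G]
  [BorelSpace G] [SecondCountableTopology G] in
/-- `-½‖P‖² - ½‖Q‖² + reInner P Q = -½‖P - Q‖²`. [folklore] -/
theorem neg_half_add_reInner (P Q : Matrix (Fin N) (Fin N) ℂ) :
    -(1 / 2 : ℝ) * hsNormSq P - (1 / 2 : ℝ) * hsNormSq Q + reInner P Q =
      -(1 / 2 : ℝ) * hsNormSq (P - Q) := by
  rw [hsNormSq_sub]; ring

omit [TopologicalSpace G] [IsTopologicalGroup G] [CompactSpace G] [MeasurableSpace G] [BorelSpace G]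
  [SecondCountableTopology G] in
/-- **The diagonal exponent does not see the crossing values of the field**:
`𝒜_g(U) + 𝒜_g(V) + Σ_c p^g_c(U) p^g_c(V)` equals an expression in which `g` enters only through
its values on the positive bonds. [cite: FriedliVelenik2017, §10.5.3, proof of Prop. 10.27] -/
theorem diag_exponent_eq (hJE : 0 ≤ JE) (hJM : 0 ≤ JM) (g : TorusSite d L × Fin d → ℂ)
    (U V : Config d L G) :
    halfExp ρ j k JE JM g U + halfExp ρ j k JE JM g V + ∑ c, feat ρ j k JE JM g c U * feat ρ j k JE JM g c V =
      JE * ∑ b ∈ Finset.univ.filter (IsPosBond j k), (eRe ρ U b + shiftTerm ρ g U b) +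
      JM * ∑ q ∈ Finset.univ.filter (IsPosPlaq j k), mRe ρ U q +
      JE * ∑ b ∈ Finset.univ.filter (IsPosBond j k), (eRe ρ V b + shiftTerm ρ g V b) +
      JM * ∑ q ∈ Finset.univ.filter (IsPosPlaq j k), mRe ρ V q -
      JE / 2 * ∑ b ∈ crossBonds j k, hsNormSq (Aplus ρ j k U b.1 - Aplus ρ j k V b.1) +
      JM * ∑ q ∈ crossPlaqs j k, reInner (Bplus ρ j k U q) (Bplus ρ j k V q) := by
  rw [sum_feat_mul_feat ρ j k JE JM hJE hJM]
  have hc : ∀ b : TorusSite d L × Fin d,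
      -(JE / 2) * hsNormSq (Aplus ρ j k U b.1 + cplus j k g b • 1) -
        JE / 2 * hsNormSq (Aplus ρ j k V b.1 + cplus j k g b • 1) +
        JE * reInner (Aplus ρ j k U b.1 + cplus j k g b • 1) (Aplus ρ j k V b.1 + cplus j k g b • 1) =
      -(JE / 2) * hsNormSq (Aplus ρ j k U b.1 - Aplus ρ j k V b.1) := by
    intro b
    have h := neg_half_add_reInner (Aplus ρ j k U b.1 + cplus j k g b • 1)
      (Aplus ρ j k V b.1 + cplus j k g b • 1)
    rw [add_sub_add_right_eq_sub] at h
    linear_combination JE * h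
  have hsum : -(JE / 2) * ∑ b ∈ crossBonds j k, hsNormSq (Aplus ρ j k U b.1 + cplus j k g b • 1) -
      JE / 2 * ∑ b ∈ crossBonds j k, hsNormSq (Aplus ρ j k V b.1 + cplus j k g b • 1) +
      JE * ∑ b ∈ crossBonds j k,
        reInner (Aplus ρ j k U b.1 + cplus j k g b • 1) (Aplus ρ j k V b.1 + cplus j k g b • 1) =
      -(JE / 2) * ∑ b ∈ crossBonds j k, hsNormSq (Aplus ρ j k U b.1 - Aplus ρ j k V b.1) := by
    rw [Finset.mul_sum, Finset.mul_sum, Finset.mul_sum, Finset.mul_sum, ← Finset.sum_sub_distrib,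
      ← Finset.sum_add_distrib]
    exact Finset.sum_congr rfl fun b _ => hc b
  unfold halfExp
  linear_combination hsum

/-- The field with its crossing values set to zero. [folklore] -/
def zeroCross (g : TorusSite d L × Fin d → ℂ) : TorusSite d L × Fin d → ℂ :=
  fun b => if IsCrossBond j k b then 0 else g b

omit [SecondCountableTopology G] in
/-- **`pairZ(g, g) = pairZ(g⁰, g⁰)`** with `g⁰` the field with vanishing crossing values. [cite: FriedliVelenik2017, §10.5.3, proof of Prop. 10.27] -/
theorem pairZ_self_eq_zeroCross (hJE : 0 ≤ JE) (hJM : 0 ≤ JM) (g : TorusSite d L × Fin d → ℂ) :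
    pairZ ρ j k JE JM g g = pairZ ρ j k JE JM (zeroCross j k g) (zeroCross j k g) := by
  unfold pairZ
  refine integral_congr_ae (ae_of_all _ fun U => ?_)
  simp only [one_mul, ← Real.exp_add]
  congr 1
  rw [diag_exponent_eq ρ j k JE JM hJE hJM, diag_exponent_eq ρ j k JE JM hJE hJM]
  have hs : ∀ W : Config d L G, ∑ b ∈ Finset.univ.filter (IsPosBond j k), (eRe ρ W b + shiftTerm ρ g W b) =
      ∑ b ∈ Finset.univ.filter (IsPosBond j k), (eRe ρ W b + shiftTerm ρ (zeroCross j k g) W b) := by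
    intro W
    refine Finset.sum_congr rfl fun b hb => ?_
    have hnc := not_isCrossBond_of_isPosBond j k (Finset.mem_filter.1 hb).2
    simp only [shiftTerm, zeroCross, hnc, if_false]
  rw [hs U, hs (reflect j k U)]

/-! #### The symmetrised fields -/

/-- The field `g♯`: `g` on the positive and crossing bonds, `θ*g` on the negative ones. [folklore] -/
def sharp (g : TorusSite d L × Fin d → ℂ) : TorusSite d L × Fin d → ℂ :=
  fun b => if IsPosBond j k b ∨ IsCrossBond j k b then g b else pullField j k g b

/-- **`h⁺`**: `h` on the positive bonds, `0` on the crossing bonds, `θ*h` on the negative bonds. [cite: FriedliVelenik2017, §10.5.3, proof of Prop. 10.27] -/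
def reflPlus (h : TorusSite d L × Fin d → ℂ) : TorusSite d L × Fin d → ℂ := sharp j k (zeroCross j k h)

/-- **`h⁻`**: `θ*h` on the positive bonds, `0` on the crossing bonds, `h` on the negative bonds. [cite: FriedliVelenik2017, §10.5.3, proof of Prop. 10.27] -/
def reflMinus (h : TorusSite d L × Fin d → ℂ) : TorusSite d L × Fin d → ℂ :=
  sharp j k (zeroCross j k (pullField j k h))

/-- The mirror of a positive bond is neither positive nor crossing. [folklore] -/
theorem bondMirror_not_pos_not_cross (hL : Even L) (hL4 : 4 ≤ L) {b : TorusSite d L × Fin d}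
    (hb : IsPosBond j k b) : ¬ IsPosBond j k (bondMirror j k b) ∧ ¬ IsCrossBond j k (bondMirror j k b) := by
  have h := obj_trichotomy (mobj := bondMirror j k) hL hL4 (bondMirror_base j k) (bondMirror_flag j k)
    (bondMirror j k b)
  rw [bondMirror_bondMirror] at h
  rcases h with h | h | h
  · exact absurd hb h.2.2
  · exact absurd hb h.2.2
  · exact ⟨h.1, h.2.1⟩

omit [NeZero L] in
/-- `g♯ = g` on the positive and crossing bonds. [folklore] -/
theorem sharp_eq_of {g : TorusSite d L × Fin d → ℂ} {b : TorusSite d L × Fin d}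
    (hb : IsPosBond j k b ∨ IsCrossBond j k b) : sharp j k g b = g b := by
  simp [sharp, hb]

/-- `θ*((g⁰)♯) = g⁰` on the positive and crossing bonds. [folklore] -/
theorem pullField_sharp_zeroCross_eq_of (hL : Even L) (hL4 : 4 ≤ L) {g : TorusSite d L × Fin d → ℂ}
    {b : TorusSite d L × Fin d} (hb : IsPosBond j k b ∨ IsCrossBond j k b) :
    pullField j k (sharp j k (zeroCross j k g)) b = zeroCross j k g b := by
  rcases hb with hb | hb
  · obtain ⟨h1, h2⟩ := bondMirror_not_pos_not_cross j k hL hL4 hb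
    have h3 : ¬ (IsPosBond j k (bondMirror j k b) ∨ IsCrossBond j k (bondMirror j k b)) := by tauto
    rw [pullField, sharp, if_neg h3, pullField, sgn_bondMirror, bondMirror_bondMirror, ← mul_assoc,
      sgn_mul_sgn, one_mul]
  · rw [pullField, bondMirror_of_isCrossBond j k hL hb, sharp_eq_of j k (Or.inr hb), zeroCross,
      if_pos hb, mul_zero]

omit [TopologicalSpace G] [IsTopologicalGroup G] [CompactSpace G] [MeasurableSpace G] [BorelSpace G]
  [SecondCountableTopology G] in
/-- `𝒜_g` depends on `g` only through its values on the positive and crossing bonds. [folklore] -/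
theorem halfExp_congr_field {g₁ g₂ : TorusSite d L × Fin d → ℂ}
    (hg : ∀ b, IsPosBond j k b ∨ IsCrossBond j k b → g₁ b = g₂ b) (U : Config d L G) :
    halfExp ρ j k JE JM g₁ U = halfExp ρ j k JE JM g₂ U := by
  have h1 : ∑ b ∈ Finset.univ.filter (IsPosBond j k), (eRe ρ U b + shiftTerm ρ g₁ U b) =
      ∑ b ∈ Finset.univ.filter (IsPosBond j k), (eRe ρ U b + shiftTerm ρ g₂ U b) :=
    Finset.sum_congr rfl fun b hb => by
      simp only [shiftTerm, hg b (Or.inl (Finset.mem_filter.1 hb).2)]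
  have h3 : ∑ b ∈ crossBonds j k, hsNormSq (Aplus ρ j k U b.1 + cplus j k g₁ b • 1) =
      ∑ b ∈ crossBonds j k, hsNormSq (Aplus ρ j k U b.1 + cplus j k g₂ b • 1) :=
    Finset.sum_congr rfl fun b hb => by
      simp only [cplus, hg b (Or.inr (Finset.mem_filter.1 hb).2)]
  unfold halfExp
  rw [h1, h3]

omit [TopologicalSpace G] [IsTopologicalGroup G] [CompactSpace G] [MeasurableSpace G] [BorelSpace G]
  [SecondCountableTopology G] in
/-- The features depend on `g` only through its values on the crossing bonds. [folklore] -/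
theorem feat_congr_field {g₁ g₂ : TorusSite d L × Fin d → ℂ}
    (hg : ∀ b, IsPosBond j k b ∨ IsCrossBond j k b → g₁ b = g₂ b) (c : Feat d L N j k)
    (U : Config d L G) : feat ρ j k JE JM g₁ c U = feat ρ j k JE JM g₂ c U := by
  rcases c with ⟨b, a, s⟩ | ⟨q, a, s⟩
  · simp only [feat, cplus, hg b.1 (Or.inr (Finset.mem_filter.1 b.2).2)]
  · simp only [feat]

/-- **`e^{J_E N #cross} pairZ(g⁰, g⁰) = Z((g⁰)♯)`.** [cite: FriedliVelenik2017, §10.5.3, proof of Prop. 10.27] -/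
theorem gaussZ_sharp_zeroCross (hL : Even L) (hL4 : 4 ≤ L) (hρu : ∀ g, ρ g ∈ Matrix.unitaryGroup (Fin N) ℂ)
    (hρ : Continuous ρ) (hJE : 0 ≤ JE) (hJM : 0 ≤ JM) (g : TorusSite d L × Fin d → ℂ) :
    gaussZ ρ JE JM (sharp j k (zeroCross j k g)) =
      Real.exp (JE * N * (crossBonds j k).card) * pairZ ρ j k JE JM (zeroCross j k g) (zeroCross j k g) := by
  rw [gaussZ_eq_pairZ ρ j k JE JM hL hL4 hρu hρ hJE hJM]
  congr 1
  unfold pairZ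
  refine integral_congr_ae (ae_of_all _ fun U => ?_)
  have h1 : ∀ b, IsPosBond j k b ∨ IsCrossBond j k b → sharp j k (zeroCross j k g) b = zeroCross j k g b :=
    fun b hb => sharp_eq_of j k hb
  have h2 : ∀ b, IsPosBond j k b ∨ IsCrossBond j k b →
      pullField j k (sharp j k (zeroCross j k g)) b = zeroCross j k g b :=
    fun b hb => pullField_sharp_zeroCross_eq_of j k hL hL4 hb
  simp only [halfExp_congr_field ρ j k JE JM h1, halfExp_congr_field ρ j k JE JM h2,
    feat_congr_field ρ j k JE JM h1, feat_congr_field ρ j k JE JM h2]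

/-- **`Z(h)² ≤ Z(h⁺) Z(h⁻)`** (Friedli–Velenik 2017, proof of Prop. 10.27, for the one-layer lattice
gauge theory and the reflection through the bond-bisecting hyperplanes `reflect j k`). [cite: FriedliVelenik2017, §10.5.3, proof of Prop. 10.27] -/
theorem gaussZ_sq_le (hL : Even L) (hL4 : 4 ≤ L) (hρu : ∀ g, ρ g ∈ Matrix.unitaryGroup (Fin N) ℂ)
    (hρ : Continuous ρ) (hJE : 0 ≤ JE) (hJM : 0 ≤ JM) (h : TorusSite d L × Fin d → ℂ) :
    gaussZ ρ JE JM h ^ 2 ≤ gaussZ ρ JE JM (reflPlus j k h) * gaussZ ρ JE JM (reflMinus j k h) := by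
  unfold reflPlus reflMinus
  rw [gaussZ_sharp_zeroCross ρ j k JE JM hL hL4 hρu hρ hJE hJM,
    gaussZ_sharp_zeroCross ρ j k JE JM hL hL4 hρu hρ hJE hJM,
    ← pairZ_self_eq_zeroCross ρ j k JE JM hJE hJM, ← pairZ_self_eq_zeroCross ρ j k JE JM hJE hJM,
    gaussZ_eq_pairZ ρ j k JE JM hL hL4 hρu hρ hJE hJM h, mul_pow]
  have hsq := pairZ_sq_le ρ j k JE JM hL hL4 hρ h (pullField j k h)
  have hE : 0 ≤ Real.exp (JE * N * (crossBonds j k).card) := (Real.exp_pos _).le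
  calc Real.exp (JE * N * (crossBonds j k).card) ^ 2 * pairZ ρ j k JE JM h (pullField j k h) ^ 2
      ≤ Real.exp (JE * N * (crossBonds j k).card) ^ 2 *
          (pairZ ρ j k JE JM h h * pairZ ρ j k JE JM (pullField j k h) (pullField j k h)) :=
        mul_le_mul_of_nonneg_left hsq (by positivity)
    _ = _ := by ring

end GaussianDominationCore

/-! ### Gaussian domination by descent on the number of non-zero bonds -/

section Descent

variable {d L : ℕ} [NeZero L]

open Classical in
/-- The number of bonds on which the field does not vanish ("bad bonds"). [cite: FriedliVelenik2017, §10.5.3, proof of Prop. 10.27] -/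
def badCount (g : TorusSite d L × Fin d → ℂ) : ℕ :=
  (Finset.univ.filter fun b => g b ≠ 0).card

open Classical in
/-- The bad-bond indicator. [folklore] -/
def badInd (g : TorusSite d L × Fin d → ℂ) (b : TorusSite d L × Fin d) : ℕ := if g b ≠ 0 then 1 else 0

/-- `#bad = Σ badInd`. [folklore] -/
theorem badCount_eq_sum (g : TorusSite d L × Fin d → ℂ) : badCount g = ∑ b, badInd g b := by
  classical
  unfold badCount badInd
  rw [Finset.card_filter]

omit [NeZero L] in
/-- `badInd ≤ 1`. [folklore] -/
theorem badInd_le_one (g : TorusSite d L × Fin d → ℂ) (b : TorusSite d L × Fin d) : badInd g b ≤ 1 := by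
  unfold badInd; split_ifs <;> omega

/-- A field without bad bonds vanishes. [folklore] -/
theorem eq_zero_of_badCount_eq_zero {g : TorusSite d L × Fin d → ℂ} (hg : badCount g = 0) : g = 0 := by
  classical
  funext b
  by_contra hb
  have : b ∈ Finset.univ.filter (fun b => g b ≠ 0) := Finset.mem_filter.2 ⟨Finset.mem_univ _, hb⟩
  rw [badCount, Finset.card_eq_zero] at hg
  rw [hg] at this
  simp at this

variable (j : Fin d) (k : ZMod L)

omit [NeZero L] in
/-- `badInd` of a `±`-multiple. [folklore] -/
theorem badInd_sgn_mul (g : TorusSite d L × Fin d → ℂ) (b b' : TorusSite d L × Fin d) :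
    badInd (fun c => sgn j b' * g c) b = badInd g b := by
  unfold badInd
  have hs : sgn j b' ≠ 0 := by
    intro h; have := norm_sgn j b'; rw [h, norm_zero] at this; exact zero_ne_one this
  simp [mul_eq_zero, hs]

/-- **The bad bonds of `h⁺`**: `#bad(h⁺) = 2 #{positive bad bonds of h}`. [cite: FriedliVelenik2017, §10.5.3, proof of Prop. 10.27] -/
theorem badCount_reflPlus (hL : Even L) (hL4 : 4 ≤ L) (h : TorusSite d L × Fin d → ℂ) :
    badCount (reflPlus j k h) = 2 * ∑ b ∈ Finset.univ.filter (IsPosBond j k), badInd h b := by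
  rw [badCount_eq_sum, sum_bond_split j k hL hL4]
  have h1 : ∑ b ∈ Finset.univ.filter (IsPosBond j k), badInd (reflPlus j k h) b =
      ∑ b ∈ Finset.univ.filter (IsPosBond j k), badInd h b := by
    refine Finset.sum_congr rfl fun b hb => ?_
    have hp := (Finset.mem_filter.1 hb).2
    unfold badInd reflPlus
    rw [sharp_eq_of j k (Or.inl hp), zeroCross, if_neg (not_isCrossBond_of_isPosBond j k hp)]
  have h2 : ∑ b ∈ crossBonds j k, badInd (reflPlus j k h) b = 0 := by
    refine Finset.sum_eq_zero fun b hb => ?_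
    have hc := (Finset.mem_filter.1 hb).2
    unfold badInd reflPlus
    rw [sharp_eq_of j k (Or.inr hc), zeroCross, if_pos hc]
    simp
  have h3 : ∑ b ∈ Finset.univ.filter (IsPosBond j k), badInd (reflPlus j k h) (bondMirror j k b) =
      ∑ b ∈ Finset.univ.filter (IsPosBond j k), badInd h b := by
    refine Finset.sum_congr rfl fun b hb => ?_
    have hp := (Finset.mem_filter.1 hb).2
    obtain ⟨hn1, hn2⟩ := bondMirror_not_pos_not_cross j k hL hL4 hp
    have hn : ¬ (IsPosBond j k (bondMirror j k b) ∨ IsCrossBond j k (bondMirror j k b)) := by tauto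
    unfold badInd reflPlus
    rw [sharp, if_neg hn, pullField, bondMirror_bondMirror, sgn_bondMirror, zeroCross,
      if_neg (not_isCrossBond_of_isPosBond j k hp)]
    exact badInd_sgn_mul j h b b
  rw [h1, h2, h3]
  ring

/-- **The bad bonds of `h⁻`**: `#bad(h⁻) = 2 #{negative bad bonds of h}`. [cite: FriedliVelenik2017, §10.5.3, proof of Prop. 10.27] -/
theorem badCount_reflMinus (hL : Even L) (hL4 : 4 ≤ L) (h : TorusSite d L × Fin d → ℂ) :
    badCount (reflMinus j k h) =
      2 * ∑ b ∈ Finset.univ.filter (IsPosBond j k), badInd h (bondMirror j k b) := by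
  rw [badCount_eq_sum, sum_bond_split j k hL hL4]
  have h1 : ∑ b ∈ Finset.univ.filter (IsPosBond j k), badInd (reflMinus j k h) b =
      ∑ b ∈ Finset.univ.filter (IsPosBond j k), badInd h (bondMirror j k b) := by
    refine Finset.sum_congr rfl fun b hb => ?_
    have hp := (Finset.mem_filter.1 hb).2
    unfold badInd reflMinus
    rw [sharp_eq_of j k (Or.inl hp), zeroCross, if_neg (not_isCrossBond_of_isPosBond j k hp), pullField]
    exact badInd_sgn_mul j (fun c => h (bondMirror j k c)) b b
  have h2 : ∑ b ∈ crossBonds j k, badInd (reflMinus j k h) b = 0 := by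
    refine Finset.sum_eq_zero fun b hb => ?_
    have hc := (Finset.mem_filter.1 hb).2
    unfold badInd reflMinus
    rw [sharp_eq_of j k (Or.inr hc), zeroCross, if_pos hc]
    simp
  have h3 : ∑ b ∈ Finset.univ.filter (IsPosBond j k), badInd (reflMinus j k h) (bondMirror j k b) =
      ∑ b ∈ Finset.univ.filter (IsPosBond j k), badInd h (bondMirror j k b) := by
    refine Finset.sum_congr rfl fun b hb => ?_
    have hp := (Finset.mem_filter.1 hb).2
    obtain ⟨hn1, hn2⟩ := bondMirror_not_pos_not_cross j k hL hL4 hp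
    have hn : ¬ (IsPosBond j k (bondMirror j k b) ∨ IsCrossBond j k (bondMirror j k b)) := by tauto
    unfold badInd reflMinus
    rw [sharp, if_neg hn, pullField, bondMirror_bondMirror, sgn_bondMirror, zeroCross,
      if_neg (not_isCrossBond_of_isPosBond j k hp), pullField, ← mul_assoc, sgn_mul_sgn, one_mul]
  rw [h1, h2, h3]
  ring

/-- **The bad-bond bookkeeping of one reflection**:
`#bad(h⁺) + #bad(h⁻) + 2 #{crossing bad bonds of h} = 2 #bad(h)`. [cite: FriedliVelenik2017, §10.5.3, proof of Prop. 10.27] -/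
theorem badCount_reflPlus_add_reflMinus (hL : Even L) (hL4 : 4 ≤ L) (h : TorusSite d L × Fin d → ℂ) :
    badCount (reflPlus j k h) + badCount (reflMinus j k h) + 2 * ∑ b ∈ crossBonds j k, badInd h b =
      2 * badCount h := by
  rw [badCount_reflPlus j k hL hL4, badCount_reflMinus j k hL hL4, badCount_eq_sum h,
    sum_bond_split j k hL hL4 (badInd h)]
  ring

omit [NeZero L] in
/-- Values of the symmetrised fields. [folklore] -/
theorem reflPlus_mem (S : Finset ℂ) (hS0 : (0 : ℂ) ∈ S) (hSneg : ∀ z ∈ S, -z ∈ S)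
    {h : TorusSite d L × Fin d → ℂ} (hh : ∀ b, h b ∈ S) (b : TorusSite d L × Fin d) :
    reflPlus j k h b ∈ S ∧ reflMinus j k h b ∈ S := by
  have hsgn : ∀ (b' : TorusSite d L × Fin d) (z : ℂ), z ∈ S → sgn j b' * z ∈ S := by
    intro b' z hz
    unfold sgn; split_ifs
    · rw [neg_one_mul]; exact hSneg z hz
    · rw [one_mul]; exact hz
  have hzc : ∀ g : TorusSite d L × Fin d → ℂ, (∀ c, g c ∈ S) → ∀ c, zeroCross j k g c ∈ S := by
    intro g hg c; unfold zeroCross; split_ifs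
    · exact hS0
    · exact hg c
  have hpf : ∀ g : TorusSite d L × Fin d → ℂ, (∀ c, g c ∈ S) → ∀ c, pullField j k g c ∈ S :=
    fun g hg c => hsgn c _ (hg _)
  have hsh : ∀ g : TorusSite d L × Fin d → ℂ, (∀ c, g c ∈ S) → ∀ c, sharp j k g c ∈ S := by
    intro g hg c; unfold sharp; split_ifs
    · exact hg c
    · exact hpf g hg c
  exact ⟨hsh _ (hzc _ hh) b, hsh _ (hzc _ (hpf _ hh)) b⟩

variable {G : Type*} [Group G] {N : ℕ} (ρ : G →* Matrix (Fin N) (Fin N) ℂ) (JE JM : ℝ)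
  [TopologicalSpace G] [IsTopologicalGroup G] [CompactSpace G] [MeasurableSpace G] [BorelSpace G]
  [SecondCountableTopology G]

omit j k in
/-- **Gaussian domination for the one-layer model** (Borgs–Seiler 1983, Lemma III.1
`|Z({h})| ≤ Z({0})`; Friedli–Velenik 2017, Prop. 10.27): on the even torus `(ℤ/L)^d`, `L ≥ 4`, for a
continuous unitary matrix representation `ρ` and `J_E, J_M ≥ 0`, `Z(h) ≤ Z(0)` for every bond field
`h`. Proof by the finite descent of Kennedy–Lieb–Shastry (as in the tree's
`GaussianDominationProofs`): among the finitely many fields with values in `{0} ∪ ±range h`, a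
maximiser of `Z` with the fewest non-zero bonds has none — otherwise reflect through the mirror
bisecting a non-zero bond (`gaussZ_sq_le`, `badCount_reflPlus_add_reflMinus`). [cite: BorgsSeiler1983, §III.1 Lemma III.1 (p. 344)] -/
theorem gaussZ_le_gaussZ_zero (hL : Even L) (hL4 : 4 ≤ L)
    (hρu : ∀ g, ρ g ∈ Matrix.unitaryGroup (Fin N) ℂ) (hρ : Continuous ρ) (hJE : 0 ≤ JE) (hJM : 0 ≤ JM)
    (h : TorusSite d L × Fin d → ℂ) :
    gaussZ ρ JE JM h ≤ gaussZ ρ JE JM (0 : TorusSite d L × Fin d → ℂ) := by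
  classical
  -- the finite set of admissible fields
  set S : Finset ℂ := insert 0 (Finset.univ.image h ∪ Finset.univ.image fun b => -h b) with hS
  have hS0 : (0 : ℂ) ∈ S := Finset.mem_insert_self _ _
  have hmemS : ∀ z : ℂ, z ∈ S ↔ z = 0 ∨ (∃ b, h b = z) ∨ ∃ b, -h b = z := fun z => by
    simp [hS]
  have hSneg : ∀ z ∈ S, -z ∈ S := by
    intro z hz
    rw [hmemS] at hz ⊢
    rcases hz with rfl | ⟨b, rfl⟩ | ⟨b, rfl⟩
    · exact Or.inl neg_zero
    · exact Or.inr (Or.inr ⟨b, rfl⟩)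
    · exact Or.inr (Or.inl ⟨b, (neg_neg _).symm⟩)
  set F : Finset (TorusSite d L × Fin d → ℂ) := Fintype.piFinset fun _ => S with hF
  have hmemF : ∀ g : TorusSite d L × Fin d → ℂ, g ∈ F ↔ ∀ b, g b ∈ S := fun g => by
    rw [hF, Fintype.mem_piFinset]
  have hhF : h ∈ F := (hmemF h).2 fun b => (hmemS _).2 (Or.inr (Or.inl ⟨b, rfl⟩))
  have h0F : (0 : TorusSite d L × Fin d → ℂ) ∈ F := (hmemF 0).2 fun _ => hS0
  -- a maximiser of `Z` on `F` with the fewest bad bonds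
  obtain ⟨g₁, hg₁F, hg₁max⟩ := F.exists_max_image (gaussZ ρ JE JM) ⟨h, hhF⟩
  set M : Finset (TorusSite d L × Fin d → ℂ) := F.filter fun g => gaussZ ρ JE JM g = gaussZ ρ JE JM g₁
    with hM
  have hg₁M : g₁ ∈ M := Finset.mem_filter.2 ⟨hg₁F, rfl⟩
  obtain ⟨g, hgM, hgmin⟩ := M.exists_min_image badCount ⟨g₁, hg₁M⟩
  obtain ⟨hgF, hgZ⟩ := Finset.mem_filter.1 hgM
  -- it has no bad bonds
  have hzero : badCount g = 0 := by
    by_contra hne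
    have hgne : g ≠ 0 := fun h0 => hne (by rw [h0, badCount]; simp)
    obtain ⟨b₀, hb₀⟩ : ∃ b₀, g b₀ ≠ 0 := by
      by_contra hall; push Not at hall; exact hgne (funext hall)
    -- reflect through the mirror bisecting `b₀`
    set j : Fin d := b₀.2
    set k : ZMod L := b₀.1 b₀.2
    have hcross : IsCrossBond j k b₀ := by
      refine ⟨rfl, Or.inl ?_⟩
      show (b₀.1 b₀.2 - b₀.1 b₀.2).val = 0
      rw [sub_self, ZMod.val_zero]
    have hsq := gaussZ_sq_le ρ j k JE JM hL hL4 hρu hρ hJE hJM g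
    have hPF : reflPlus j k g ∈ F := (hmemF _).2 fun b =>
      (reflPlus_mem j k S hS0 hSneg ((hmemF g).1 hgF) b).1
    have hMF : reflMinus j k g ∈ F := (hmemF _).2 fun b =>
      (reflPlus_mem j k S hS0 hSneg ((hmemF g).1 hgF) b).2
    have hZg : 0 < gaussZ ρ JE JM g := gaussZ_pos ρ hρ JE JM g
    have hP_le : gaussZ ρ JE JM (reflPlus j k g) ≤ gaussZ ρ JE JM g := hgZ ▸ hg₁max _ hPF
    have hM_le : gaussZ ρ JE JM (reflMinus j k g) ≤ gaussZ ρ JE JM g := hgZ ▸ hg₁max _ hMF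
    have hPpos : 0 < gaussZ ρ JE JM (reflPlus j k g) := gaussZ_pos ρ hρ JE JM _
    have hMpos : 0 < gaussZ ρ JE JM (reflMinus j k g) := gaussZ_pos ρ hρ JE JM _
    -- both reflected fields are maximisers too
    have hP_eq : gaussZ ρ JE JM (reflPlus j k g) = gaussZ ρ JE JM g := by
      refine le_antisymm hP_le ?_
      by_contra hlt
      push Not at hlt
      have : gaussZ ρ JE JM (reflPlus j k g) * gaussZ ρ JE JM (reflMinus j k g) <
          gaussZ ρ JE JM g * gaussZ ρ JE JM g :=
        mul_lt_mul hlt hM_le hMpos hZg.le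
      nlinarith
    have hM_eq : gaussZ ρ JE JM (reflMinus j k g) = gaussZ ρ JE JM g := by
      refine le_antisymm hM_le ?_
      by_contra hlt
      push Not at hlt
      have : gaussZ ρ JE JM (reflPlus j k g) * gaussZ ρ JE JM (reflMinus j k g) <
          gaussZ ρ JE JM g * gaussZ ρ JE JM g :=
        mul_lt_mul' hP_le hlt hMpos.le hZg
      nlinarith
    have hPM : reflPlus j k g ∈ M := Finset.mem_filter.2 ⟨hPF, hP_eq.trans hgZ⟩
    have hMM : reflMinus j k g ∈ M := Finset.mem_filter.2 ⟨hMF, hM_eq.trans hgZ⟩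
    have h1 := hgmin _ hPM
    have h2 := hgmin _ hMM
    have hcount := badCount_reflPlus_add_reflMinus j k hL hL4 g
    have hb₀ : 1 ≤ ∑ b ∈ crossBonds j k, badInd g b := by
      have hmem : b₀ ∈ crossBonds j k := Finset.mem_filter.2 ⟨Finset.mem_univ _, hcross⟩
      have : badInd g b₀ = 1 := by unfold badInd; rw [if_pos hb₀]
      calc 1 = badInd g b₀ := this.symm
        _ ≤ ∑ b ∈ crossBonds j k, badInd g b :=
          Finset.single_le_sum (f := badInd g) (fun _ _ => Nat.zero_le _) hmem
    omega
  have hg0 : g = 0 := eq_zero_of_badCount_eq_zero hzero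
  calc gaussZ ρ JE JM h ≤ gaussZ ρ JE JM g₁ := hg₁max h hhF
    _ = gaussZ ρ JE JM g := hgZ.symm
    _ = gaussZ ρ JE JM 0 := by rw [hg0]

end Descent

end OneLayer

end Literature.Barriers.QuantumFields

end
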